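import Literature.NumberTheory.LFunctions.ZeroDensityGuthMaynard
import Literature.NumberTheory.LFunctions.DirichletPolynomialLargeValues
import Literature.NumberTheory.LFunctions.AFEHarmonicSums
import HarnessLib

/-!
# Guth–Maynard §13.1: the zero-detecting method for Theorem 1.2 (proofs only)

Trunk T-ANT (`Literature/NumberTheory/LFunctions`), family RH, statement **rh.S12**. Companion of
`ZeroDensityGuthMaynard.lean` (the assembly of the named fact
`Literature.NumberTheory.LFunctions.zeroDensity_thirty_thirteenths` and its reduction
`isBigO_zetaZeroCountRe_window_of_wellSpaced` to a count of well-separated zeros at dyadic heights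
on the window `7/10 ≤ σ ≤ 4/5`). This file formalises the part of L. Guth, J. Maynard, *New large
value estimates for Dirichlet polynomials*, Ann. of Math. (2) 203 (2026) = arXiv:2405.20552, §13.1
(proof of Theorem 1.2) that does NOT depend on their new large values estimate (Theorem 1.1):
PROOFS ONLY, no definition and no named fact is introduced (D-0026).

## Source, as printed (§13.1, second paragraph)

"Given a parameter `N = 2^j`, we let `b_n := (∑_{d ∣ n, d ≤ 2T^{1/100}} μ(d)) exp(−n/T^{1/2})`,
`D(s) := ∑_{n ∼ N} b_n n^{-s}`. Then, a non-trivial zero `ρ = β + iγ` of `ζ(s)` with `β ≥ σ` and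
`γ ∈ [T, 2T]` is called a 'Type I zero' if there is a choice of
`N = 2^j ∈ [T^{1/100}, T^{1/2}(log T)²]` such that `|D(ρ)| ≥ 1/(3 log T)`. If it is not a Type I zero
then it is a 'Type II zero', and the number of Type II zeros is `≤ T^{2−2σ}(log T)^{O(1)}` by [MP]."

In the tree the zero-detecting identity behind this dichotomy is PROVED
(`HuxleyZeroDensity.zeroDetection_integral`, Huxley Ch. 23 with Mellin's kernel `Γ(w)`): with the
mollifier `M_X(s) = ∑_{d ≤ X} μ(d) d^{-s}` and `a_X(n) = ∑_{d ∣ n, d ≤ X} μ(d)` — so that GM's `b_n` is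
exactly the tree's smoothed coefficient `a_X(n) e^{-n/Y}` with `X = 2T^{1/100}`, `Y = T^{1/2}` — every
zero `ρ = β + iγ` with `β ≥ 1/2 + δ` is of class (i),
`|∑_{X < n ≤ 100 l Y} a_X(n) e^{-n/Y} n^{-ρ}| > 1/3` (GM's Type I after dyadic splitting), or
satisfies the class (ii) condition
`∫_{|y| ≤ 100 l} |ζ(1/2 + i(γ+y)) M_X(1/2 + i(γ+y))| dy ≥ 2⁻²⁰ δ Y^{β−1/2}` (GM's Type II).

## What this file proves

* `GuthMaynardZeroDensity.card_typeII_le` — **the Type II count**: a set of points `ρ = β + iγ`,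
  `β ≥ σ`, `U < γ ≤ 2U`, ordinates pairwise `≥ 2A` apart, each satisfying the class (ii) condition
  on the window `[γ − A, γ + A]`, has at most `2⁸⁷ A³ X² C₄ (3U)^{1+η} / (δ⁴ Y^{4σ−2})` elements,
  where `∫_0^T |ζ(1/2+it)|⁴ dt ≤ C₄ T^{1+η}`: Cauchy–Schwarz on the window
  (`∫ |ζ|² ≥ (2⁻²⁰ δ Y^{σ−1/2})² / ∫ |M_X|²`, `|M_X(1/2+it)| ≤ 2√X`) and the fourth moment of `ζ` on
  the disjoint windows (`HuxleyZeroDensity.card_classTwoA_le`). With `Y = T^{1/2}`, `X = T^{1/100}`,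
  `A = 100 log T` and the tree's proved weak fourth moment (`zetaFourthMomentWeak`) this is
  `≪ T^{2−2σ+1/50+η} log³ T` (and `2 − 2σ + 1/50 < 15(1−σ)/(3+5σ)` on the window).
* `GuthMaynardZeroDensity.beta_removal` — **removing the real parts** with FIXED coefficients:
  GM use a smooth `ψ(u) = e^{u(σ−β)}` and Fourier inversion; here `n^{-β} = n^{-σ} M^{-(β−σ)}
  e^{-(β−σ) log(n/M)}` and the exponential series truncated at `J₁` terms (pigeonhole over the
  Taylor index `j < J₁`), which serves the same purpose: a block polynomial large at `ρ = β + iγ`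
  yields one of `J₁` polynomials with coefficients `c(n) n^{-σ} log^j(n/M)` — independent of `β` —
  large at the ordinate `γ`.
* `GuthMaynardZeroDensity.card_le_of_power` — **the `k`-th power device**: for `1`-separated real
  points where `|∑_{M<n≤2M} b_n n^{-it}| ≥ V₂` (`|b_n| ≤ 1`), the `k`-th power is a Dirichlet
  polynomial on `(M^k, (2M)^k]` with coefficients `≤ d(m)^k` (`DirichletLargeValues.pow_sum_eq_sum_fiber`,
  `card_filter_prod_eq_le_pow`); its most popular dyadic piece is counted once by the
  HYPOTHESIS `hL` — the statement of Guth–Maynard's Theorem 1.1 at a fixed exponent `ε₁`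
  (lengths `N ≤ T²`) — and once by the discrete mean value theorem PROVED in the tree
  (`sum_norm_sq_dirichletPoly_le`).
* `GuthMaynardZeroDensity.exponents`, `case_bounds`, `k_choice` — the exponent bookkeeping of
  §13.1: `T^{10/(6+10σ)} ≤ N^k ≤ T^{15/(6+10σ)}` (`k ≤ 77` as `N ≥ T^{1/100}`; `k = 2` when
  `N > T^{5/(6+10σ)}`), `α = 15(1−σ)/((3+5σ)(18/5−4σ))`, and the identity
  `1 + (1−2σ)α = 15(1−σ)/(3+5σ) − (250(σ−3/4)² + 3/8)/(2(3+5σ)(9−10σ))`.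
* `GuthMaynardZeroDensity.block_bound`, `GuthMaynardZeroDensity.card_typeI_le` — **the Type I
  count, conditionally on Theorem 1.1**: with all bookkeeping quantities dominated by one
  parameter `Λ` (to be taken `≍ T^{o(1)}`), the number of points `ρ = β + iγ` (`σ ≤ β ≤ 1`,
  `0 ≤ γ ≤ T`, ordinates `1`-separated) with `|∑_{X<n≤N₀} c(n) n^{-ρ}| > 1/3` (`|c(n)| ≤ d(n)`,
  `T^{1/100} ≤ X`, `N₀² ≤ T^{15/14}`) is at most `16¹⁰⁰ Λ¹⁵⁴⁷ T^{15(1−σ)/(3+5σ)}` for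
  `7/10 ≤ σ ≤ 4/5`, GIVEN `hL`.

Nothing here asserts Theorem 1.1: it enters only as the explicit hypothesis `hL` of
`card_le_of_power`, `block_bound` and `card_typeI_le` (no definition, no named fact).

## Relation to `ZeroDensityGuthMaynardWindow.lean`, and what remains (status 2026-08-15)

The assembly of these counts into Theorem 1.2 on the window — thinning to well-separated
ordinates, the dichotomy `HuxleyZeroDensity.zeroDetection_integral` with `X = ⌈T^{1/100}⌉`,
`Y = T^{1/2}`, the bookkeeping parameter `Λ ≍ T^{o(1)}`, absorption of the logarithms — is NOT
repeated here: the tree's `ZeroDensityGuthMaynardWindow.lean` (written independently and in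
parallel for the companion fact `zeroDensity_guth_maynard`) proves the whole deduction
"Theorem 1.1 ⇒ Theorem 1.2 on `[7/10, 4/5]`" with its own Type I/Type II counts
(`GuthMaynardWindow.wellSpaced_gm`, `isBigO_zetaZeroCountRe_window_of_largeValues`), with
Theorem 1.1 as the hypothesis `hLV` in the slightly more economical form "`N ≤ T`, `T ≥ T₀(ε)`".
Both named facts are reduced to Theorem 1.1 alone through it:
`zeroDensity_guth_maynard_of_largeValues` (there) and `zeroDensity_thirty_thirteenths_of_largeValues`
(`ZeroDensityGuthMaynard.lean`). The lemmas of the present file (`beta_removal`,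
`card_le_of_power`, `block_bound`, `card_typeI_le`, `card_typeII_le`) are an alternative,
self-contained toolkit for the same two counts, kept for reuse.

What remains for the discharges is exactly Guth–Maynard's Theorem 1.1 (§§3–12 of the paper,
resting on Heath-Brown's Theorem 1.6); neither is in the tree.

## References

* L. Guth, J. Maynard, *New large value estimates for Dirichlet polynomials*, Ann. of Math. (2) 203
  (2026), no. 2, 623–675; arXiv:2405.20552 — §13.1.
* J. Maynard, K. Pratt, *Half-isolated zeros and zero-density estimates*, IMRN 2024, no. 19 — the
  reference [MP] for the Type II count (not consulted; the count is proved here from the fourth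
  moment as in Huxley, Ch. 28, (28.5)–(28.6)).
* M. N. Huxley, *The Distribution of Prime Numbers*, Oxford 1972, Ch. 23 and Ch. 28.
-/

noncomputable section

open Real Set Filter Topology Complex MeasureTheory Finset Asymptotics

namespace Literature.NumberTheory.LFunctions

namespace GuthMaynardZeroDensity

open ZeroDetect (mollifier norm_mollifier_le)

/-! ## §1. Type II zeros (class (ii)): the fourth moment of `ζ` on disjoint windows -/

/-- `|M_X(s)| ≤ 2√X` for `Re s = 1/2`. [folklore] -/
theorem norm_mollifier_half_le (X : ℕ) {s : ℂ} (hs : s.re = 1 / 2) :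
    ‖mollifier X s‖ ≤ 2 * Real.sqrt X := by
  unfold ZeroDetect.mollifier
  refine le_trans (norm_sum_le _ _)
    (le_trans (Finset.sum_le_sum fun d hd ↦ ?_) (AFE.sum_Icc_rpow_neg_half_le X))
  simp only [Finset.mem_Icc] at hd
  have hd0 : (0 : ℝ) < d := by exact_mod_cast hd.1
  rw [norm_mul, show ((d : ℂ)) = ((d : ℝ) : ℂ) by norm_cast,
    Complex.norm_cpow_eq_rpow_re_of_pos hd0, neg_re, hs]
  have h1 : ‖((ArithmeticFunction.moebius d : ℤ) : ℂ)‖ ≤ 1 := by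
    rw [Complex.norm_intCast]; exact_mod_cast ArithmeticFunction.abs_moebius_le_one
  exact mul_le_of_le_one_left (Real.rpow_nonneg hd0.le _) h1

/-- **The Type II count** (Guth–Maynard §13.1: "the number of Type II zeros is
`≤ T^{2−2σ}(log T)^{O(1)}`"; here in the parametrised form of Huxley Ch. 28, (28.5)–(28.6)). Let
`1 ≤ U`, `0 < A ≤ U`, `X ≥ 1`, `Y ≥ 1`, `δ > 0`, and let `Z` be a finite set of points `ρ = β + iγ`
with `β ≥ σ`, `U < γ ≤ 2U`, ordinates pairwise `≥ 2A` apart, each satisfying the class (ii)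
condition `∫_{-A}^{A} |ζ(1/2 + i(γ+y)) M_X(1/2 + i(γ+y))| dy ≥ 2⁻²⁰ δ Y^{β − 1/2}`. If
`∫_0^T |ζ(1/2+it)|⁴ dt ≤ C₄ T^{1+η}` for `T ≥ 1`, then
`|Z| ≤ 2⁸⁷ A³ X² C₄ (3U)^{1+η} / (δ⁴ Y^{4σ−2})`. Proof: on each window, by Cauchy–Schwarz and
`|M_X(1/2+it)| ≤ 2√X`, `∫_{-A}^{A} |ζ(1/2+i(γ+y))|² dy ≥ (2⁻²⁰ δ Y^{σ−1/2})² / (8AX)`; the windows are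
disjoint, so the fourth moment counts them (`HuxleyZeroDensity.card_classTwoA_le`).
[cite: GuthMaynard2024, §13.1 (proof of Thm. 1.2, second paragraph)] -/
theorem card_typeII_le {U A : ℝ} (hU : 1 ≤ U) (hA0 : 0 < A) (hAU : A ≤ U) {X : ℕ} (hX : 1 ≤ X)
    {Y δ σ : ℝ} (hY : 1 ≤ Y) (hδ : 0 < δ) (Z : Finset ℂ)
    (hZ : ∀ ρ ∈ Z, σ ≤ ρ.re ∧ U < ρ.im ∧ ρ.im ≤ 2 * U)
    (hsep : ∀ ρ ∈ Z, ∀ ρ' ∈ Z, ρ ≠ ρ' → 2 * A ≤ |ρ.im - ρ'.im|)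
    (hII : ∀ ρ ∈ Z, δ * Y ^ (ρ.re - 1 / 2) / 2 ^ 20 ≤
      ∫ y in (-A)..A, ‖riemannZeta (1 / 2 + ((ρ.im + y : ℝ) : ℂ) * I) *
        mollifier X (1 / 2 + ((ρ.im + y : ℝ) : ℂ) * I)‖)
    {C₄ η : ℝ}
    (h4 : ∀ T : ℝ, 1 ≤ T → ∫ t in (0 : ℝ)..T, ‖riemannZeta (1 / 2 + t * I)‖ ^ 4 ≤ C₄ * T ^ (1 + η)) :
    (Z.card : ℝ) ≤ 2 ^ 87 * A ^ 3 * (X : ℝ) ^ 2 * (C₄ * (3 * U) ^ (1 + η)) /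
      (δ ^ 4 * Y ^ (4 * σ - 2)) := by
  have hY0 : 0 < Y := by linarith
  have hX0 : (0 : ℝ) < X := by exact_mod_cast hX
  -- the common lower bound `W₀ = 2⁻²⁰ δ Y^{σ-1/2}` for the class (ii) integrals
  set P : ℝ := Y ^ (σ - 1 / 2) with hP
  have hP0 : 0 < P := Real.rpow_pos_of_pos hY0 _
  set W₀ : ℝ := δ * P / 2 ^ 20 with hW₀
  have hW₀0 : 0 < W₀ := by positivity
  -- the lower bound for `∫ |ζ|²` on each window
  set W : ℝ := W₀ ^ 2 / (8 * A * (X : ℝ)) with hW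
  have hW0 : 0 < W := by positivity
  have hlarge : ∀ ρ ∈ Z, W ≤ ∫ y in (-A)..A, ‖riemannZeta (1 / 2 + ((ρ.im + y : ℝ) : ℂ) * I)‖ ^ 2 := by
    intro ρ hρ
    obtain ⟨hβ, -, -⟩ := hZ ρ hρ
    set f : ℝ → ℝ := fun y ↦ ‖riemannZeta (1 / 2 + ((ρ.im + y : ℝ) : ℂ) * I)‖ with hf
    set g : ℝ → ℝ := fun y ↦ ‖mollifier X (1 / 2 + ((ρ.im + y : ℝ) : ℂ) * I)‖ with hg
    have hfc : Continuous f := (FourthMoment.continuous_zeta_half_line'.comp (by fun_prop)).norm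
    have hgc : Continuous g := ((ZeroDensity.continuous_mollifier_half_line X).comp (by fun_prop)).norm
    -- `W₀ ≤ ∫ f g`
    have hPle : P ≤ Y ^ (ρ.re - 1 / 2) :=
      Real.rpow_le_rpow_of_exponent_le hY (by linarith)
    have h1 : W₀ ≤ ∫ y in (-A)..A, f y * g y := by
      have e : ∫ y in (-A)..A, f y * g y =
          ∫ y in (-A)..A, ‖riemannZeta (1 / 2 + ((ρ.im + y : ℝ) : ℂ) * I) *
            mollifier X (1 / 2 + ((ρ.im + y : ℝ) : ℂ) * I)‖ :=
        intervalIntegral.integral_congr fun y _ ↦ (norm_mul _ _).symm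
      rw [e]
      refine le_trans ?_ (hII ρ hρ)
      rw [hW₀]
      exact div_le_div_of_nonneg_right (mul_le_mul_of_nonneg_left hPle hδ.le) (by positivity)
    -- Cauchy–Schwarz
    have hCS := ZeroDensity.sq_integral_mul_le (a := -A) (b := A) (by linarith) hfc hgc
    -- `∫ g² ≤ 8 A X`
    have hg2 : ∫ y in (-A)..A, g y ^ 2 ≤ 8 * A * (X : ℝ) := by
      have hle : ∀ y, g y ^ 2 ≤ 4 * (X : ℝ) := fun y ↦ by
        have h := norm_mollifier_half_le X (s := 1 / 2 + ((ρ.im + y : ℝ) : ℂ) * I) (by simp)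
        calc g y ^ 2 ≤ (2 * Real.sqrt X) ^ 2 := pow_le_pow_left₀ (norm_nonneg _) h 2
          _ = 4 * (X : ℝ) := by rw [mul_pow, Real.sq_sqrt hX0.le]; ring
      calc ∫ y in (-A)..A, g y ^ 2 ≤ ∫ y in (-A)..A, 4 * (X : ℝ) :=
            intervalIntegral.integral_mono_on (by linarith)
              ((hgc.pow 2).intervalIntegrable _ _) (by simp) fun y _ ↦ hle y
        _ = 8 * A * (X : ℝ) := by
            rw [intervalIntegral.integral_const, smul_eq_mul]; ring
    have hf2 : 0 ≤ ∫ y in (-A)..A, f y ^ 2 :=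
      intervalIntegral.integral_nonneg (by linarith) fun y _ ↦ sq_nonneg _
    -- combine: `W₀² ≤ (∫ f²) · 8AX`
    have h2 : W₀ ^ 2 ≤ (∫ y in (-A)..A, f y ^ 2) * (8 * A * (X : ℝ)) :=
      calc W₀ ^ 2 ≤ (∫ y in (-A)..A, f y * g y) ^ 2 := pow_le_pow_left₀ hW₀0.le h1 2
        _ ≤ (∫ y in (-A)..A, f y ^ 2) * ∫ y in (-A)..A, g y ^ 2 := hCS
        _ ≤ (∫ y in (-A)..A, f y ^ 2) * (8 * A * (X : ℝ)) :=
            mul_le_mul_of_nonneg_left hg2 hf2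
    rw [hW, div_le_iff₀ (by positivity)]
    exact h2
  -- the fourth moment on the disjoint windows
  have hZ' : ∀ ρ ∈ Z, U < ρ.im ∧ ρ.im ≤ 2 * U := fun ρ hρ ↦ ⟨(hZ ρ hρ).2.1, (hZ ρ hρ).2.2⟩
  have key := HuxleyZeroDensity.card_classTwoA_le hU hA0 hAU Z hZ' hsep hlarge h4 hW0.le
  -- unwind `W`
  have hP4 : P ^ 4 = Y ^ (4 * σ - 2) := by
    rw [hP, ← Real.rpow_natCast (Y ^ (σ - 1 / 2)), ← Real.rpow_mul hY0.le]
    congr 1; push_cast; ring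
  have hW2 : W ^ 2 * (2 ^ 86 * A ^ 2 * (X : ℝ) ^ 2) = δ ^ 4 * P ^ 4 := by
    rw [hW, hW₀]; field_simp; ring
  rw [le_div_iff₀ (by positivity), ← hP4]
  calc (Z.card : ℝ) * (δ ^ 4 * P ^ 4) = (Z.card : ℝ) * W ^ 2 * (2 ^ 86 * A ^ 2 * (X : ℝ) ^ 2) := by
        rw [← hW2]; ring
    _ ≤ 2 * A * (C₄ * (3 * U) ^ (1 + η)) * (2 ^ 86 * A ^ 2 * (X : ℝ) ^ 2) :=
        mul_le_mul_of_nonneg_right key (by positivity)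
    _ = 2 ^ 87 * A ^ 3 * (X : ℝ) ^ 2 * (C₄ * (3 * U) ^ (1 + η)) := by ring

/-! ## §2. Elementary tools for the Type I count -/

/-- Conjugation symmetry of a Dirichlet polynomial at real points:
`‖∑ a_n n^{-it}‖ = ‖∑ conj(a_n) n^{it}‖`. [folklore] -/
theorem norm_sum_conj_cpow (s : Finset ℕ) (a : ℕ → ℂ) (t : ℝ) :
    ‖∑ n ∈ s, a n * (n : ℂ) ^ (-((t : ℂ) * I))‖ =
      ‖∑ n ∈ s, (starRingEnd ℂ) (a n) * (n : ℂ) ^ ((t : ℂ) * I)‖ := by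
  rw [← Complex.norm_conj, map_sum]
  congr 1
  refine Finset.sum_congr rfl fun n _ ↦ ?_
  rw [map_mul]
  congr 1
  have hs : (starRingEnd ℂ) (-((t : ℂ) * I)) = (t : ℂ) * I := by
    rw [map_neg, map_mul, Complex.conj_ofReal, Complex.conj_I]; ring
  have harg : ((n : ℂ)).arg ≠ Real.pi := by
    rw [Complex.natCast_arg]; exact Real.pi_ne_zero.symm
  conv_rhs => rw [← hs, Complex.cpow_conj _ _ harg, map_natCast]

/-- Taylor's bound for the real exponential on `|x| ≤ 1`:
`|e^x − ∑_{m<n} x^m/m!| ≤ 2|x|^n` (`n ≥ 1`). [folklore] -/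
theorem abs_exp_sub_sum_le {x : ℝ} (hx : |x| ≤ 1) {n : ℕ} (hn : 1 ≤ n) :
    |Real.exp x - ∑ m ∈ Finset.range n, x ^ m / m.factorial| ≤ 2 * |x| ^ n := by
  have h := Real.exp_bound hx hn
  refine h.trans ?_
  rw [mul_comm]
  refine mul_le_mul_of_nonneg_right ?_ (pow_nonneg (abs_nonneg _) _)
  -- `(n+1)/(n! n) ≤ 2`
  have hn1 : (1 : ℝ) ≤ n := by exact_mod_cast hn
  have hfact : (1 : ℝ) ≤ n.factorial := by exact_mod_cast n.factorial_pos
  rw [show ((n.succ : ℕ) : ℝ) = n + 1 by push_cast; ring, div_le_iff₀ (by positivity)]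
  nlinarith [mul_le_mul hfact hn1 (by norm_num) (by linarith)]

/-- The number of `k`-tuples from a finite set of naturals with prescribed nonzero product `n` is at
most `d(n)^k` (every coordinate divides `n`). [folklore] -/
theorem card_filter_prod_eq_le_pow (k : ℕ) (t : Finset ℕ) {n : ℕ} (hn : n ≠ 0) :
    ((Fintype.piFinset fun _ : Fin k ↦ t).filter (fun u ↦ ∏ i, u i = n)).card ≤
      n.divisors.card ^ k := by
  classical
  calc ((Fintype.piFinset fun _ : Fin k ↦ t).filter (fun u ↦ ∏ i, u i = n)).card
      ≤ (Fintype.piFinset fun _ : Fin k ↦ n.divisors).card := by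
        refine Finset.card_le_card fun u hu ↦ ?_
        rw [Finset.mem_filter] at hu
        rw [Fintype.mem_piFinset]
        intro i
        rw [Nat.mem_divisors]
        refine ⟨?_, hn⟩
        rw [← hu.2]
        exact Finset.dvd_prod_of_mem _ (Finset.mem_univ i)
    _ = n.divisors.card ^ k := by
        rw [Fintype.card_piFinset, Finset.prod_const, Finset.card_univ, Fintype.card_fin]

/-! ## §3. The exponent bookkeeping of §13.1 -/

/-- The two ranges and signs used below: for `7/10 ≤ σ ≤ 4/5`, `κ = 15(1−σ)/(3+5σ)`,
`a₁ = 10/(6+10σ)`, `a₂ = 15/(6+10σ)`, `α = 75(1−σ)/((3+5σ)(18−20σ))`: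
`a₂(2−2σ) = κ`, `α(18/5−4σ) = κ`, `1 + a₁(12/5−4σ) = κ`, `1 + α(1−2σ) ≤ κ`, together with
`0 < a₁ ≤ α`… (only what is used). [cite: GuthMaynard2024, §13.1 (proof of Thm. 1.2, last paragraph)] -/
theorem exponents {σ : ℝ} (h₀ : 7 / 10 ≤ σ) (h₁ : σ ≤ 4 / 5) :
    15 / (6 + 10 * σ) * (2 - 2 * σ) = 15 * (1 - σ) / (3 + 5 * σ) ∧
    75 * (1 - σ) / ((3 + 5 * σ) * (18 - 20 * σ)) * (18 / 5 - 4 * σ) = 15 * (1 - σ) / (3 + 5 * σ) ∧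
    1 + 10 / (6 + 10 * σ) * (12 / 5 - 4 * σ) = 15 * (1 - σ) / (3 + 5 * σ) ∧
    1 + 75 * (1 - σ) / ((3 + 5 * σ) * (18 - 20 * σ)) * (1 - 2 * σ) ≤ 15 * (1 - σ) / (3 + 5 * σ) ∧
    0 < 10 / (6 + 10 * σ) ∧ 10 / (6 + 10 * σ) < 15 / (6 + 10 * σ) ∧ 15 / (6 + 10 * σ) ≤ 15 / 13 ∧
    1 < 15 / (6 + 10 * σ) ∧ 0 < 75 * (1 - σ) / ((3 + 5 * σ) * (18 - 20 * σ)) ∧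
    0 < 15 * (1 - σ) / (3 + 5 * σ) ∧ 15 * (1 - σ) / (3 + 5 * σ) ≤ 1 := by
  have h3 : 0 < 3 + 5 * σ := by linarith
  have h6 : 0 < 6 + 10 * σ := by linarith
  have h18 : 0 < 18 - 20 * σ := by linarith
  have hD : 0 < (3 + 5 * σ) * (18 - 20 * σ) := mul_pos h3 h18
  have h3' := h3.ne'
  have h6' := h6.ne'
  have h18' := h18.ne'
  refine ⟨?_, ?_, ?_, ?_, ?_, ?_, ?_, ?_, ?_, ?_, ?_⟩
  · field_simp; ring
  · rw [div_mul_eq_mul_div, div_eq_div_iff hD.ne' h3']; ring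
  · field_simp; ring
  · have key : 0 ≤ 15 * (1 - σ) * (18 - 20 * σ) -
        ((3 + 5 * σ) * (18 - 20 * σ) + 75 * (1 - σ) * (1 - 2 * σ)) := by
      nlinarith [sq_nonneg (σ - 3 / 4)]
    rw [div_mul_eq_mul_div, one_add_div hD.ne', div_le_div_iff₀ hD h3]
    nlinarith [mul_nonneg key h3.le]
  · positivity
  · exact div_lt_div_of_pos_right (by norm_num) h6
  · rw [div_le_div_iff₀ h6 (by norm_num)]; linarith
  · rw [lt_div_iff₀ h6]; linarith
  · exact div_pos (by linarith) hD
  · exact div_pos (by linarith) h3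
  · rw [div_le_one h3]; linarith


/-- Monotonicity in the base for a nonnegative exponent, composed with `(T^a)^e = T^{ae}`.
[folklore] -/
theorem rpow_le_rpow_mul_of_le {Q T a e : ℝ} (hQ : 0 ≤ Q) (hT : 0 ≤ T) (h : Q ≤ T ^ a)
    (he : 0 ≤ e) : Q ^ e ≤ T ^ (a * e) := by
  rw [Real.rpow_mul hT]
  exact Real.rpow_le_rpow hQ h he

/-- Antitonicity in the base for a nonpositive exponent, composed with `(T^a)^e = T^{ae}`.
[folklore] -/
theorem rpow_le_rpow_mul_of_ge {Q T a e : ℝ} (hT : 0 < T) (h : T ^ a ≤ Q) (he : e ≤ 0) :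
    Q ^ e ≤ T ^ (a * e) := by
  rw [Real.rpow_mul hT.le]
  exact Real.rpow_le_rpow_of_nonpos (Real.rpow_pos_of_pos hT a) h he

/-- **The case analysis of §13.1** ("If `N, k` are such that `N^k ≤ T^α`, then we apply Theorem 1.1
… If instead we have `N^k > T^α`, then we apply the usual Mean Value Theorem"). For
`7/10 ≤ σ ≤ 4/5`, `T ≥ 1` and `T^{10/(6+10σ)} ≤ Q ≤ T^{15/(6+10σ)}` (`Q = N^k`), with
`κ = 15(1−σ)/(3+5σ)` and `α = 75(1−σ)/((3+5σ)(18−20σ))`: if `Q ≤ T^α` then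
`Q^{2−2σ}, Q^{18/5−4σ}, T Q^{12/5−4σ} ≤ T^κ`; if `T^α ≤ Q` then `Q^{2−2σ}, T Q^{1−2σ} ≤ T^κ`.
[cite: GuthMaynard2024, §13.1 (proof of Thm. 1.2, last paragraph)] -/
theorem case_bounds {σ : ℝ} (h₀ : 7 / 10 ≤ σ) (h₁ : σ ≤ 4 / 5) {T Q : ℝ} (hT : 1 ≤ T) (hQ : 0 < Q)
    (hQ₁ : T ^ (10 / (6 + 10 * σ)) ≤ Q) (hQ₂ : Q ≤ T ^ (15 / (6 + 10 * σ))) :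
    (Q ^ (2 - 2 * σ) ≤ T ^ (15 * (1 - σ) / (3 + 5 * σ))) ∧
    (Q ≤ T ^ (75 * (1 - σ) / ((3 + 5 * σ) * (18 - 20 * σ))) →
      Q ^ (18 / 5 - 4 * σ) ≤ T ^ (15 * (1 - σ) / (3 + 5 * σ)) ∧
      T * Q ^ (12 / 5 - 4 * σ) ≤ T ^ (15 * (1 - σ) / (3 + 5 * σ))) ∧
    (T ^ (75 * (1 - σ) / ((3 + 5 * σ) * (18 - 20 * σ))) ≤ Q →
      T * Q ^ (1 - 2 * σ) ≤ T ^ (15 * (1 - σ) / (3 + 5 * σ))) := by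
  obtain ⟨e1, e2, e3, e4, -, -, -, -, -, -, -⟩ := exponents h₀ h₁
  have hT0 : 0 < T := by linarith
  refine ⟨?_, fun hQα ↦ ⟨?_, ?_⟩, fun hQα ↦ ?_⟩
  · rw [← e1]
    exact rpow_le_rpow_mul_of_le hQ.le hT0.le hQ₂ (by linarith)
  · rw [← e2]
    exact rpow_le_rpow_mul_of_le hQ.le hT0.le hQα (by linarith)
  · rw [← e3, Real.rpow_add hT0, Real.rpow_one]
    exact mul_le_mul_of_nonneg_left (rpow_le_rpow_mul_of_ge hT0 hQ₁ (by linarith)) hT0.le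
  · have h := rpow_le_rpow_mul_of_ge hT0 hQα (by linarith : 1 - 2 * σ ≤ 0)
    calc T * Q ^ (1 - 2 * σ) ≤ T * T ^ (75 * (1 - σ) / ((3 + 5 * σ) * (18 - 20 * σ)) * (1 - 2 * σ)) :=
          mul_le_mul_of_nonneg_left h hT0.le
      _ = T ^ (1 + 75 * (1 - σ) / ((3 + 5 * σ) * (18 - 20 * σ)) * (1 - 2 * σ)) := by
          rw [Real.rpow_add hT0, Real.rpow_one]
      _ ≤ T ^ (15 * (1 - σ) / (3 + 5 * σ)) := Real.rpow_le_rpow_of_exponent_le hT e4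

/-- **The choice of `k`** (§13.1: "We can then choose a value of `k ≪ 1` such that
`T^{10/(6+10σ)} ≤ N^k ≤ T^{15/(6+10σ)}`. This is clearly possible if `N ≤ T^{5/(6+10σ)}`, whereas if
`N > T^{5/(6+10σ)}` we can take `k = 2`"). Here `N ≥ T^{1/100}` gives `k ≤ 77`, and the case
`k = 2` uses `N² ≤ T^{15/(6+10σ)}`. [cite: GuthMaynard2024, §13.1 (proof of Thm. 1.2, eq. (13.1))] -/
theorem k_choice {σ : ℝ} (h₀ : 7 / 10 ≤ σ) {T N : ℝ} (hT : 1 < T)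
    (hN : T ^ (1 / 100 : ℝ) ≤ N) (hN2 : N ^ 2 ≤ T ^ (15 / (6 + 10 * σ))) :
    ∃ k : ℕ, 1 ≤ k ∧ k ≤ 77 ∧ T ^ (10 / (6 + 10 * σ)) ≤ N ^ k ∧ N ^ k ≤ T ^ (15 / (6 + 10 * σ)) := by
  classical
  have hT0 : 0 < T := by linarith
  have hT1 : 1 ≤ T := hT.le
  have hN1 : 1 < N := lt_of_lt_of_le (Real.one_lt_rpow hT (by norm_num)) hN
  have hN0 : 0 < N := by linarith
  have h6 : 0 < 6 + 10 * σ := by linarith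
  set a₁ : ℝ := 10 / (6 + 10 * σ) with ha₁
  set a₂ : ℝ := 15 / (6 + 10 * σ) with ha₂
  have ha₁le : a₁ ≤ 77 / 100 := by
    rw [ha₁, div_le_div_iff₀ h6 (by norm_num)]; linarith
  have ha₂₁ : a₂ - a₁ = 5 / (6 + 10 * σ) := by rw [ha₂, ha₁]; field_simp; ring
  have ha₁eq : a₁ = 2 * (a₂ - a₁) := by rw [ha₂₁, ha₁]; field_simp; ring
  by_cases hcase : N ≤ T ^ (a₂ - a₁)
  · -- the least `k` with `T^{a₁} ≤ N^k`
    have hex : ∃ k : ℕ, T ^ a₁ ≤ N ^ k := ⟨77, by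
      calc T ^ a₁ ≤ T ^ (77 / 100 : ℝ) := Real.rpow_le_rpow_of_exponent_le hT1 ha₁le
        _ = (T ^ (1 / 100 : ℝ)) ^ (77 : ℕ) := by
            rw [← Real.rpow_natCast, ← Real.rpow_mul hT0.le]; norm_num
        _ ≤ N ^ 77 := pow_le_pow_left₀ (Real.rpow_nonneg hT0.le _) hN 77⟩
    set k := Nat.find hex with hk
    have hk_spec : T ^ a₁ ≤ N ^ k := Nat.find_spec hex
    have hk77 : k ≤ 77 := Nat.find_min' hex (by
      calc T ^ a₁ ≤ T ^ (77 / 100 : ℝ) := Real.rpow_le_rpow_of_exponent_le hT1 ha₁le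
        _ = (T ^ (1 / 100 : ℝ)) ^ (77 : ℕ) := by
            rw [← Real.rpow_natCast, ← Real.rpow_mul hT0.le]; norm_num
        _ ≤ N ^ 77 := pow_le_pow_left₀ (Real.rpow_nonneg hT0.le _) hN 77)
    have hk1 : 1 ≤ k := by
      by_contra h0
      have hk0 : k = 0 := by omega
      rw [hk0, pow_zero] at hk_spec
      have : 1 < T ^ a₁ := Real.one_lt_rpow hT (by rw [ha₁]; positivity)
      linarith
    have hkm : ¬ T ^ a₁ ≤ N ^ (k - 1) := Nat.find_min hex (by omega)
    rw [not_le] at hkm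
    refine ⟨k, hk1, hk77, hk_spec, ?_⟩
    calc N ^ k = N ^ (k - 1) * N := by rw [← pow_succ, Nat.sub_add_cancel hk1]
      _ ≤ T ^ a₁ * T ^ (a₂ - a₁) := mul_le_mul hkm.le hcase hN0.le (Real.rpow_nonneg hT0.le _)
      _ = T ^ a₂ := by rw [← Real.rpow_add hT0]; ring_nf
  · rw [not_le] at hcase
    refine ⟨2, by norm_num, by norm_num, ?_, hN2⟩
    have h2 : (a₂ - a₁) * ((2 : ℕ) : ℝ) = a₁ := by push_cast; linarith [ha₁eq]
    calc T ^ a₁ = (T ^ (a₂ - a₁)) ^ (2 : ℕ) := by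
          rw [← Real.rpow_natCast, ← Real.rpow_mul hT0.le, h2]
      _ ≤ N ^ 2 := pow_le_pow_left₀ (Real.rpow_nonneg hT0.le _) hcase.le 2

/-! ## §4. Removing the real parts -/

/-- **Removing the real parts** (Guth–Maynard §13.1: "We now make a slight modification to `D` to
remove the dependencies on the real parts"; there by a smooth partition `ψ(u) = e^{u(σ−β)}` and
Fourier inversion, here by the exponential series, which keeps the coefficients FIXED). Let `M ≥ 1`,
`σ ≤ β ≤ σ + 3/10`, `J₁ ≥ 1`, `V > 0`, and suppose `|∑_{M<n≤2M} c(n) n^{-ρ}| ≥ V` (`ρ = β + iγ`)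
while the tail `2 (21/100)^{J₁} ∑_{M<n≤2M} |c(n)| n^{-σ}` is at most `V/2`. Then for some `j < J₁`,
`|∑_{M<n≤2M} c(n) n^{-σ} log^j(n/M) · n^{-iγ}| ≥ V/(2J₁)`: write
`n^{-β} = n^{-σ} M^{-(β−σ)} e^{-(β−σ) log(n/M)}`, expand the exponential to order `J₁`
(`0 ≤ (β−σ) log(n/M) ≤ (3/10) log 2 ≤ 21/100`) and pigeonhole over `j`.
[cite: GuthMaynard2024, §13.1 (proof of Thm. 1.2, third paragraph)] -/
theorem beta_removal {M : ℕ} (hM : 1 ≤ M) (c : ℕ → ℂ) {σ : ℝ} {ρ : ℂ} (hβ : σ ≤ ρ.re)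
    (hβ' : ρ.re ≤ σ + 3 / 10) {J₁ : ℕ} (hJ₁ : 1 ≤ J₁) {V : ℝ} (hV : 0 < V)
    (hlarge : V ≤ ‖∑ n ∈ Finset.Ioc M (2 * M), c n * (n : ℂ) ^ (-ρ)‖)
    (htail : 2 * (21 / 100 : ℝ) ^ J₁ * ∑ n ∈ Finset.Ioc M (2 * M), ‖c n‖ * (n : ℝ) ^ (-σ) ≤ V / 2) :
    ∃ j < J₁, V / (2 * J₁) ≤ ‖∑ n ∈ Finset.Ioc M (2 * M),
      c n * (((n : ℝ) ^ (-σ) * Real.log ((n : ℝ) / M) ^ j : ℝ) : ℂ) * (n : ℂ) ^ (-((ρ.im : ℂ) * I))‖ := by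
  -- notation
  set d : ℝ := ρ.re - σ with hd
  have hd0 : 0 ≤ d := by rw [hd]; linarith
  have hd3 : d ≤ 3 / 10 := by rw [hd]; linarith
  have hM0 : (0 : ℝ) < M := by exact_mod_cast hM
  have hJ₁0 : (0 : ℝ) < J₁ := by exact_mod_cast hJ₁
  set S : Finset ℕ := Finset.Ioc M (2 * M) with hS
  set u : ℕ → ℝ := fun n ↦ Real.log ((n : ℝ) / M) with hu
  set x : ℕ → ℝ := fun n ↦ -(d * u n) with hx
  set a : ℕ → ℂ := fun n ↦ c n * (((n : ℝ) ^ (-σ) : ℝ) : ℂ) * (n : ℂ) ^ (-((ρ.im : ℂ) * I)) with ha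
  have hmemS : ∀ n ∈ S, 0 < n ∧ M < n ∧ n ≤ 2 * M := fun n hn ↦ by
    rw [hS, Finset.mem_Ioc] at hn; exact ⟨by omega, hn.1, hn.2⟩
  -- `0 ≤ u n ≤ log 2` on the block
  have hu_bounds : ∀ n ∈ S, 0 ≤ u n ∧ u n ≤ Real.log 2 := by
    intro n hn
    obtain ⟨hn0, hMn, hn2⟩ := hmemS n hn
    have hn0' : (0 : ℝ) < n := by exact_mod_cast hn0
    have h1 : (1 : ℝ) ≤ (n : ℝ) / M := by
      rw [le_div_iff₀ hM0, one_mul]; exact_mod_cast hMn.le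
    have h2 : (n : ℝ) / M ≤ 2 := by
      rw [div_le_iff₀ hM0]; exact_mod_cast hn2
    exact ⟨Real.log_nonneg h1, Real.log_le_log (by positivity) h2⟩
  have hx_abs : ∀ n ∈ S, |x n| ≤ 21 / 100 := by
    intro n hn
    obtain ⟨hu0, hu2⟩ := hu_bounds n hn
    rw [hx]; dsimp only
    rw [abs_neg, abs_of_nonneg (mul_nonneg hd0 hu0)]
    have hlog2 : Real.log 2 ≤ 7 / 10 := by linarith [Real.log_two_lt_d9]
    calc d * u n ≤ (3 / 10) * (7 / 10) := mul_le_mul hd3 (hu2.trans hlog2) hu0 (by norm_num)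
      _ = 21 / 100 := by norm_num
  -- (a) the factorisation `n^{-ρ} = n^{-σ} · M^{-d} e^{x n} · n^{-iγ}`
  have hρd : ρ - (σ : ℂ) - (d : ℂ) = (ρ.im : ℂ) * I := by
    apply Complex.ext
    · simp [hd]
    · simp [hd]
  have hfac : ∀ n ∈ S, c n * (n : ℂ) ^ (-ρ) =
      ((((M : ℝ) ^ (-d) : ℝ) : ℂ)) * (a n * ((Real.exp (x n) : ℝ) : ℂ)) := by
    intro n hn
    obtain ⟨hn0, -, -⟩ := hmemS n hn
    have hn0' : (0 : ℝ) < n := by exact_mod_cast hn0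
    have hne : n ≠ 0 := by omega
    rw [HuxleyZeroDensity.natCast_cpow_neg_eq_mul n hne ρ σ,
      HuxleyZeroDensity.natCast_cpow_neg_eq_mul n hne (ρ - σ) d, hρd]
    have hreal : (n : ℝ) ^ (-d) = (M : ℝ) ^ (-d) * Real.exp (x n) := by
      rw [Real.rpow_def_of_pos hn0', Real.rpow_def_of_pos hM0, ← Real.exp_add, hx, hu]
      congr 1
      dsimp only
      rw [Real.log_div hn0'.ne' hM0.ne']
      ring
    rw [hreal, ha]
    push_cast
    ring
  have hsum_fac : ∑ n ∈ S, c n * (n : ℂ) ^ (-ρ) =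
      ((((M : ℝ) ^ (-d) : ℝ) : ℂ)) * ∑ n ∈ S, a n * ((Real.exp (x n) : ℝ) : ℂ) := by
    rw [Finset.mul_sum]
    exact Finset.sum_congr rfl hfac
  -- (b) `V ≤ ‖∑ a n e^{x n}‖`
  have hMd : ‖((((M : ℝ) ^ (-d) : ℝ) : ℂ))‖ ≤ 1 := by
    rw [Complex.norm_real, Real.norm_of_nonneg (Real.rpow_nonneg hM0.le _)]
    exact Real.rpow_le_one_of_one_le_of_nonpos (by exact_mod_cast hM) (by linarith)
  have hV1 : V ≤ ‖∑ n ∈ S, a n * ((Real.exp (x n) : ℝ) : ℂ)‖ := by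
    have h := hlarge
    rw [hsum_fac, norm_mul] at h
    exact h.trans (mul_le_of_le_one_left (norm_nonneg _) hMd)
  -- (c) Taylor expansion of `e^{x n}`
  set r : ℕ → ℝ := fun n ↦ Real.exp (x n) - ∑ j ∈ Finset.range J₁, x n ^ j / j.factorial with hr
  have hr_abs : ∀ n ∈ S, |r n| ≤ 2 * (21 / 100 : ℝ) ^ J₁ := by
    intro n hn
    have h1 : |x n| ≤ 1 := (hx_abs n hn).trans (by norm_num)
    calc |r n| ≤ 2 * |x n| ^ J₁ := abs_exp_sub_sum_le h1 hJ₁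
      _ ≤ 2 * (21 / 100 : ℝ) ^ J₁ := by
          gcongr
          exact hx_abs n hn
  -- the sums `S j`
  set Sj : ℕ → ℂ := fun j ↦ ∑ n ∈ S, a n * (((u n) ^ j : ℝ) : ℂ) with hSj
  have hexpand : ∑ n ∈ S, a n * ((Real.exp (x n) : ℝ) : ℂ) =
      ∑ j ∈ Finset.range J₁, (((-d) ^ j / j.factorial : ℝ) : ℂ) * Sj j +
        ∑ n ∈ S, a n * ((r n : ℝ) : ℂ) := by
    have h1 : ∀ n ∈ S, a n * ((Real.exp (x n) : ℝ) : ℂ) =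
        ∑ j ∈ Finset.range J₁, (((-d) ^ j / j.factorial : ℝ) : ℂ) * (a n * (((u n) ^ j : ℝ) : ℂ)) +
          a n * ((r n : ℝ) : ℂ) := by
      intro n hn
      have he : Real.exp (x n) = ∑ j ∈ Finset.range J₁, x n ^ j / j.factorial + r n := by
        rw [hr]; ring
      rw [he]
      push_cast
      rw [mul_add, Finset.mul_sum]
      congr 1
      refine Finset.sum_congr rfl fun j _ ↦ ?_
      rw [hx]; dsimp only
      push_cast
      ring
    rw [Finset.sum_congr rfl h1, Finset.sum_add_distrib, Finset.sum_comm]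
    congr 1
    refine Finset.sum_congr rfl fun j _ ↦ ?_
    rw [hSj, Finset.mul_sum]
  -- (d) the error term is at most `V/2`
  have ha_norm : ∀ n ∈ S, ‖a n‖ = ‖c n‖ * (n : ℝ) ^ (-σ) := by
    intro n hn
    obtain ⟨hn0, -, -⟩ := hmemS n hn
    rw [ha]; dsimp only
    rw [norm_mul, norm_mul, Complex.norm_real, Real.norm_of_nonneg (Real.rpow_nonneg (by positivity) _)]
    have : ‖(n : ℂ) ^ (-((ρ.im : ℂ) * I))‖ = 1 := by
      rw [show ((n : ℂ)) = ((n : ℝ) : ℂ) by norm_cast,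
        Complex.norm_cpow_eq_rpow_re_of_pos (by exact_mod_cast hn0)]
      simp
    rw [this, mul_one]
  have herr : ‖∑ n ∈ S, a n * ((r n : ℝ) : ℂ)‖ ≤ V / 2 := by
    calc ‖∑ n ∈ S, a n * ((r n : ℝ) : ℂ)‖ ≤ ∑ n ∈ S, ‖a n * ((r n : ℝ) : ℂ)‖ := norm_sum_le _ _
      _ ≤ ∑ n ∈ S, ‖c n‖ * (n : ℝ) ^ (-σ) * (2 * (21 / 100 : ℝ) ^ J₁) := by
          refine Finset.sum_le_sum fun n hn ↦ ?_
          rw [norm_mul, ha_norm n hn, Complex.norm_real, Real.norm_eq_abs]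
          exact mul_le_mul_of_nonneg_left (hr_abs n hn) (by positivity)
      _ = 2 * (21 / 100 : ℝ) ^ J₁ * ∑ n ∈ S, ‖c n‖ * (n : ℝ) ^ (-σ) := by
          rw [Finset.mul_sum]
          exact Finset.sum_congr rfl fun n _ ↦ by ring
      _ ≤ V / 2 := htail
  -- (e) the main part is at least `V/2`, pigeonhole over `j`
  have hmain : V / 2 ≤ ‖∑ j ∈ Finset.range J₁, (((-d) ^ j / j.factorial : ℝ) : ℂ) * Sj j‖ := by
    have h := hV1
    rw [hexpand] at h
    have := norm_add_le (∑ j ∈ Finset.range J₁, (((-d) ^ j / j.factorial : ℝ) : ℂ) * Sj j)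
      (∑ n ∈ S, a n * ((r n : ℝ) : ℂ))
    linarith
  obtain ⟨j, hj, hjlarge⟩ : ∃ j ∈ Finset.range J₁,
      V / (2 * J₁) ≤ ‖(((-d) ^ j / j.factorial : ℝ) : ℂ) * Sj j‖ := by
    by_contra hcon
    push Not at hcon
    have hne : (Finset.range J₁).Nonempty := ⟨0, by simp; omega⟩
    have hlt : ∑ j ∈ Finset.range J₁, ‖(((-d) ^ j / j.factorial : ℝ) : ℂ) * Sj j‖ <
        ∑ j ∈ Finset.range J₁, V / (2 * J₁) := Finset.sum_lt_sum_of_nonempty hne hcon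
    rw [Finset.sum_const, Finset.card_range, nsmul_eq_mul] at hlt
    have e : (J₁ : ℝ) * (V / (2 * J₁)) = V / 2 := by field_simp
    rw [e] at hlt
    linarith [norm_sum_le (Finset.range J₁) (fun j ↦ (((-d) ^ j / j.factorial : ℝ) : ℂ) * Sj j)]
  refine ⟨j, Finset.mem_range.1 hj, ?_⟩
  -- `‖(-d)^j/j!‖ ≤ 1`
  have hcoef : ‖(((-d) ^ j / j.factorial : ℝ) : ℂ)‖ ≤ 1 := by
    rw [Complex.norm_real, Real.norm_eq_abs, abs_div, abs_pow, abs_neg, abs_of_nonneg hd0,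
      Nat.abs_cast]
    have h1 : d ^ j ≤ 1 := pow_le_one₀ hd0 (by linarith)
    have h2 : (1 : ℝ) ≤ j.factorial := by exact_mod_cast j.factorial_pos
    exact (div_le_one (by positivity)).2 (h1.trans h2)
  have hSj_eq : Sj j = ∑ n ∈ S,
      c n * (((n : ℝ) ^ (-σ) * Real.log ((n : ℝ) / M) ^ j : ℝ) : ℂ) * (n : ℂ) ^ (-((ρ.im : ℂ) * I)) := by
    rw [hSj]; dsimp only
    refine Finset.sum_congr rfl fun n _ ↦ ?_
    rw [ha, hu]
    push_cast
    ring
  rw [← hSj_eq]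
  calc V / (2 * J₁) ≤ ‖(((-d) ^ j / j.factorial : ℝ) : ℂ) * Sj j‖ := hjlarge
    _ = ‖(((-d) ^ j / j.factorial : ℝ) : ℂ)‖ * ‖Sj j‖ := norm_mul _ _
    _ ≤ 1 * ‖Sj j‖ := mul_le_mul_of_nonneg_right hcoef (norm_nonneg _)
    _ = ‖Sj j‖ := one_mul _

/-! ## §5. Large values of a `k`-th power -/

/-- **Large values of a `k`-th power** (Guth–Maynard §13.1: "we apply Theorem 1.1 to the Dirichlet
polynomial `D̃^k`" / "we apply the usual Mean Value Theorem to `D̃^k`"). Let `D(t) = ∑_{M<n≤2M} b_n n^{-it}`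
with `|b_n| ≤ 1`, and let `W ⊂ [0, T]` be a `1`-separated finite set with `|D(t)| ≥ V₂ > 0` on `W`.
The `k`-th power `D^k = ∑_{M^k < m ≤ (2M)^k} B_m m^{-it}` has `|B_m| ≤ d(m)^k ≤ B_d`; splitting its
range into the `k` dyadic blocks `(2^i M^k, 2^{i+1} M^k]`, some block polynomial is `≥ V₂^k/k` at
`t`, and the most popular block carries `≥ |W|/k` points. Counting that block (length
`N' ≤ 2^k M^k ≤ T²`, coefficients `B_m/B_d`) once by the large values hypothesis `hL` (the
statement of Guth–Maynard's Theorem 1.1 at a fixed `ε₁`, for lengths `N ≤ T²`) and once by the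
discrete mean value theorem (`sum_norm_sq_dirichletPoly_le`, PROVED in the tree) gives the two
bounds. [cite: GuthMaynard2024, §13.1 (proof of Thm. 1.2, fourth paragraph)] -/
theorem card_le_of_power {C_L ε₁ : ℝ} (hCL : 0 ≤ C_L)
    (hL : ∀ (N : ℕ) (T V : ℝ) (b : ℕ → ℂ) (W : Finset ℝ), 1 ≤ N → 2 ≤ T → (N : ℝ) ≤ T ^ 2 →
      0 < V → (∀ n, ‖b n‖ ≤ 1) → (∀ t ∈ W, 0 ≤ t ∧ t ≤ T) →
      (∀ t ∈ W, ∀ t' ∈ W, t ≠ t' → 1 ≤ |t - t'|) →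
      (∀ t ∈ W, V ≤ ‖∑ n ∈ Finset.Icc N (2 * N), b n * (n : ℂ) ^ ((t : ℂ) * I)‖) →
      (W.card : ℝ) ≤ C_L * T ^ ε₁ * ((N : ℝ) ^ 2 * V⁻¹ ^ 2 + (N : ℝ) ^ (18 / 5 : ℝ) * V⁻¹ ^ 4 +
        T * (N : ℝ) ^ (12 / 5 : ℝ) * V⁻¹ ^ 4))
    {T : ℝ} (hT : 2 ≤ T) {k : ℕ} (hk : 1 ≤ k) {M : ℕ} (hM : 1 ≤ M)
    (hMT : (M : ℝ) ^ k * 2 ^ k ≤ T ^ 2)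
    (b : ℕ → ℂ) (hb : ∀ n, ‖b n‖ ≤ 1) {Bd : ℝ} (hBd1 : 1 ≤ Bd)
    (hBd : ∀ m : ℕ, 1 ≤ m → m ≤ M ^ k * 2 ^ k → ((m.divisors.card : ℝ)) ^ k ≤ Bd)
    (W : Finset ℝ) (hW : ∀ t ∈ W, 0 ≤ t ∧ t ≤ T)
    (hsep : ∀ t ∈ W, ∀ t' ∈ W, t ≠ t' → 1 ≤ |t - t'|) {V₂ : ℝ} (hV₂ : 0 < V₂)
    (hlarge : ∀ t ∈ W, V₂ ≤ ‖∑ n ∈ Finset.Ioc M (2 * M), b n * (n : ℂ) ^ (-((t : ℂ) * I))‖) :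
    (W.card : ℝ) ≤ k * (C_L * T ^ ε₁ *
        (((M : ℝ) ^ k * 2 ^ k) ^ 2 * (V₂ ^ k / (k * Bd))⁻¹ ^ 2 +
          ((M : ℝ) ^ k * 2 ^ k) ^ (18 / 5 : ℝ) * (V₂ ^ k / (k * Bd))⁻¹ ^ 4 +
          T * ((M : ℝ) ^ k * 2 ^ k) ^ (12 / 5 : ℝ) * (V₂ ^ k / (k * Bd))⁻¹ ^ 4)) ∧
    (W.card : ℝ) ≤ k * (72 * (T + 2 * ((M : ℝ) ^ k * 2 ^ k)) * Real.log (4 * ((M : ℝ) ^ k * 2 ^ k)) *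
        ((M : ℝ) ^ k * 2 ^ k) * Bd ^ 2 * ((k : ℝ) / V₂ ^ k) ^ 2) := by
  classical
  -- notation
  have hk0 : (0 : ℝ) < k := by exact_mod_cast hk
  have hkne : k ≠ 0 := by omega
  have hM0 : (0 : ℝ) < M := by exact_mod_cast hM
  have hT1 : 1 ≤ T := by linarith
  set S : Finset ℕ := Finset.Ioc M (2 * M) with hS
  set Mk : ℕ := M ^ k with hMk
  have hMk1 : 1 ≤ Mk := Nat.one_le_pow _ _ hM
  set Nk : ℕ := Mk * 2 ^ k with hNk
  have hNkR : ((Nk : ℕ) : ℝ) = (M : ℝ) ^ k * 2 ^ k := by rw [hNk, hMk]; push_cast; ring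
  have hNk0 : (0 : ℝ) < (M : ℝ) ^ k * 2 ^ k := by positivity
  have hNk1 : (1 : ℝ) ≤ (M : ℝ) ^ k * 2 ^ k := by
    rw [← hNkR]; exact_mod_cast Nat.one_le_iff_ne_zero.2 (by positivity)
  -- the coefficients of the `k`-th power
  set U : Finset (Fin k → ℕ) := Fintype.piFinset fun _ : Fin k ↦ S with hU
  set B : ℕ → ℂ := fun m ↦ ∑ u ∈ U.filter (fun u ↦ ∏ i, u i = m), ∏ i, b (u i) with hB
  have hmemS : ∀ n ∈ S, M + 1 ≤ n ∧ n ≤ 2 * M := fun n hn ↦ by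
    rw [hS, Finset.mem_Ioc] at hn; exact ⟨hn.1, hn.2⟩
  have hprod_mem : ∀ u ∈ U, (M + 1) ^ k ≤ ∏ i, u i ∧ ∏ i, u i ≤ Nk := by
    intro u hu
    rw [hU, Fintype.mem_piFinset] at hu
    constructor
    · calc (M + 1) ^ k = ∏ _i : Fin k, (M + 1) := by simp
        _ ≤ ∏ i, u i := Finset.prod_le_prod (fun i _ ↦ by positivity) fun i _ ↦ (hmemS _ (hu i)).1
    · calc ∏ i, u i ≤ ∏ _i : Fin k, (2 * M) :=
            Finset.prod_le_prod (fun i _ ↦ by positivity) fun i _ ↦ (hmemS _ (hu i)).2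
        _ = Nk := by simp [hNk, hMk, mul_pow, mul_comm]
  have hMk_lt : Mk < (M + 1) ^ k := by
    rw [hMk]; exact Nat.pow_lt_pow_left (Nat.lt_succ_self M) hkne
  have hprod_Icc : ∀ u ∈ U, ∏ i, u i ∈ Finset.Icc 1 Nk := by
    intro u hu
    obtain ⟨h1, h2⟩ := hprod_mem u hu
    rw [Finset.mem_Icc]
    exact ⟨le_trans (Nat.one_le_iff_ne_zero.2 (by positivity)) (le_trans hMk1 (le_trans hMk_lt.le h1)), h2⟩
  -- `D(t)^k = ∑_{m ∈ Icc 1 Nk} B m m^{-it}`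
  have hpow : ∀ t : ℝ, (∑ n ∈ S, b n * (n : ℂ) ^ (-((t : ℂ) * I))) ^ k =
      ∑ m ∈ Finset.Icc 1 Nk, B m * (m : ℂ) ^ (-((t : ℂ) * I)) := by
    intro t
    rw [DirichletLargeValues.pow_sum_eq_sum_fiber k S b ((t : ℂ) * I) Nk hprod_Icc]
  -- `B m = 0` for `m ≤ Mk`
  have hBzero : ∀ m, m ≤ Mk → B m = 0 := by
    intro m hm
    rw [hB]; dsimp only
    refine Finset.sum_eq_zero fun u hu ↦ ?_
    exfalso
    rw [Finset.mem_filter] at hu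
    have := (hprod_mem u hu.1).1
    rw [hu.2] at this
    omega
  -- `‖B m‖ ≤ Bd` for `1 ≤ m ≤ Nk`
  have hBnorm : ∀ m, 1 ≤ m → m ≤ Nk → ‖B m‖ ≤ Bd := by
    intro m hm1 hm2
    have hcard := card_filter_prod_eq_le_pow k S (n := m) (by omega)
    calc ‖B m‖ ≤ ∑ u ∈ U.filter (fun u ↦ ∏ i, u i = m), ‖∏ i, b (u i)‖ := norm_sum_le _ _
      _ ≤ ∑ u ∈ U.filter (fun u ↦ ∏ i, u i = m), (1 : ℝ) := by
          refine Finset.sum_le_sum fun u _ ↦ ?_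
          rw [norm_prod]
          calc ∏ i, ‖b (u i)‖ ≤ ∏ _i : Fin k, (1 : ℝ) :=
                Finset.prod_le_prod (fun i _ ↦ norm_nonneg _) fun i _ ↦ hb _
            _ = 1 := by simp
      _ = ((U.filter (fun u ↦ ∏ i, u i = m)).card : ℝ) := by simp
      _ ≤ ((m.divisors.card ^ k : ℕ) : ℝ) := by rw [hU]; exact_mod_cast hcard
      _ ≤ Bd := by push_cast; exact hBd m hm1 hm2
  -- the dyadic pieces
  set P : ℕ → ℝ → ℂ := fun i t ↦
    ∑ m ∈ Finset.Ioc (Mk * 2 ^ i) (Mk * 2 ^ (i + 1)), B m * (m : ℂ) ^ (-((t : ℂ) * I)) with hP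
  have hsplit : ∀ t : ℝ, ∑ m ∈ Finset.Icc 1 Nk, B m * (m : ℂ) ^ (-((t : ℂ) * I)) =
      ∑ i ∈ Finset.range k, P i t := by
    intro t
    have hunion : Finset.Icc 1 Nk = Finset.Icc 1 Mk ∪ Finset.Ioc Mk (Mk * 2 ^ k) := by
      ext m; simp only [Finset.mem_Icc, Finset.mem_union, Finset.mem_Ioc, hNk]
      constructor
      · intro h; by_cases hm : m ≤ Mk
        · exact Or.inl ⟨h.1, hm⟩
        · exact Or.inr ⟨by omega, h.2⟩
      · rintro (h | h)
        · refine ⟨h.1, h.2.trans ?_⟩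
          exact Nat.le_mul_of_pos_right _ (by positivity)
        · exact ⟨by omega, h.2⟩
    have hdisj : Disjoint (Finset.Icc 1 Mk) (Finset.Ioc Mk (Mk * 2 ^ k)) := by
      rw [Finset.disjoint_left]
      intro m h1 h2
      simp only [Finset.mem_Icc] at h1
      simp only [Finset.mem_Ioc] at h2
      omega
    rw [hunion, Finset.sum_union hdisj]
    have hfirst : ∑ m ∈ Finset.Icc 1 Mk, B m * (m : ℂ) ^ (-((t : ℂ) * I)) = 0 := by
      refine Finset.sum_eq_zero fun m hm ↦ ?_
      rw [Finset.mem_Icc] at hm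
      rw [hBzero m hm.2, zero_mul]
    rw [hfirst, zero_add, ZeroDensity.sum_Ioc_mul_two_pow]
  -- every point of `W` has a large piece
  set V' : ℝ := V₂ ^ k / k with hV'
  have hV'0 : 0 < V' := by positivity
  set Wi : ℕ → Finset ℝ := fun i ↦ W.filter (fun t ↦ V' ≤ ‖P i t‖) with hWi
  have hcover : W ⊆ (Finset.range k).biUnion Wi := by
    intro t ht
    have h1 : V₂ ^ k ≤ ‖∑ i ∈ Finset.range k, P i t‖ := by
      rw [← hsplit t, ← hpow t, norm_pow]
      exact pow_le_pow_left₀ hV₂.le (hlarge t ht) k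
    obtain ⟨i, hi, hge⟩ := HuxleyIvic.exists_block_ge hk h1
    rw [Finset.mem_biUnion]
    exact ⟨i, hi, by rw [hWi, Finset.mem_filter]; exact ⟨ht, hge⟩⟩
  have hcard_le : (W.card : ℝ) ≤ ∑ i ∈ Finset.range k, ((Wi i).card : ℝ) := by
    calc (W.card : ℝ) ≤ (((Finset.range k).biUnion Wi).card : ℝ) := by
          exact_mod_cast Finset.card_le_card hcover
      _ ≤ ∑ i ∈ Finset.range k, ((Wi i).card : ℝ) := by exact_mod_cast Finset.card_biUnion_le
  have hWi_sub : ∀ i, Wi i ⊆ W := fun i ↦ Finset.filter_subset _ _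
  -- properties of one block
  have hblock : ∀ i ∈ Finset.range k,
      let N' : ℕ := Mk * 2 ^ i
      1 ≤ N' ∧ (N' : ℝ) ≤ (M : ℝ) ^ k * 2 ^ k ∧ 2 * N' = Mk * 2 ^ (i + 1) ∧ 2 * N' ≤ Nk := by
    intro i hi
    rw [Finset.mem_range] at hi
    refine ⟨Nat.one_le_iff_ne_zero.2 (by positivity), ?_, by ring, ?_⟩
    · rw [← hNkR, hNk]; exact_mod_cast Nat.mul_le_mul_left _ (Nat.pow_le_pow_right (by norm_num) hi.le)
    · rw [hNk, show 2 * (Mk * 2 ^ i) = Mk * 2 ^ (i + 1) by ring]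
      exact Nat.mul_le_mul_left _ (Nat.pow_le_pow_right (by norm_num) (by omega))
  constructor
  · -- the large values hypothesis on each block
    have hbound : ∀ i ∈ Finset.range k, ((Wi i).card : ℝ) ≤ C_L * T ^ ε₁ *
        (((M : ℝ) ^ k * 2 ^ k) ^ 2 * (V₂ ^ k / (k * Bd))⁻¹ ^ 2 +
          ((M : ℝ) ^ k * 2 ^ k) ^ (18 / 5 : ℝ) * (V₂ ^ k / (k * Bd))⁻¹ ^ 4 +
          T * ((M : ℝ) ^ k * 2 ^ k) ^ (12 / 5 : ℝ) * (V₂ ^ k / (k * Bd))⁻¹ ^ 4) := by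
      intro i hi
      obtain ⟨hN'1, hN'le, h2N', h2N'le⟩ := hblock i hi
      set N' : ℕ := Mk * 2 ^ i with hN'
      -- normalised conjugate coefficients on `(N', 2N']`
      set b' : ℕ → ℂ := fun n ↦ if N' < n ∧ n ≤ 2 * N' then (starRingEnd ℂ) (B n) / Bd else 0
        with hb'
      have hb'1 : ∀ n, ‖b' n‖ ≤ 1 := by
        intro n
        rw [hb']; dsimp only
        split_ifs with h
        · rw [norm_div, Complex.norm_conj, Complex.norm_real, Real.norm_of_nonneg (by linarith),
            div_le_one (by linarith)]
          exact hBnorm n (by omega) (by omega)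
        · simp
      set V'' : ℝ := V₂ ^ k / (k * Bd) with hV''
      have hV''0 : 0 < V'' := by positivity
      have hlarge' : ∀ t ∈ Wi i, V'' ≤ ‖∑ n ∈ Finset.Icc N' (2 * N'), b' n * (n : ℂ) ^ ((t : ℂ) * I)‖ := by
        intro t ht
        rw [hWi, Finset.mem_filter] at ht
        have hPi := ht.2
        -- `∑_{Icc N' 2N'} b' n n^{it} = (conj-sum over Ioc N' 2N') / Bd`
        have hsum : ∑ n ∈ Finset.Icc N' (2 * N'), b' n * (n : ℂ) ^ ((t : ℂ) * I) =
            (∑ n ∈ Finset.Ioc N' (2 * N'), (starRingEnd ℂ) (B n) * (n : ℂ) ^ ((t : ℂ) * I)) / Bd := by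
          have hsub : Finset.Ioc N' (2 * N') ⊆ Finset.Icc N' (2 * N') := Finset.Ioc_subset_Icc_self
          rw [Finset.sum_div, ← Finset.sum_subset (f := fun n ↦ b' n * (n : ℂ) ^ ((t : ℂ) * I)) hsub ?_]
          · refine Finset.sum_congr rfl fun n hn ↦ ?_
            rw [Finset.mem_Ioc] at hn
            rw [hb']; dsimp only
            rw [if_pos ⟨hn.1, hn.2⟩]; ring
          · intro n _ hn'
            rw [Finset.mem_Ioc] at hn'
            rw [hb']; dsimp only
            rw [if_neg hn', zero_mul]
        rw [hsum, norm_div, Complex.norm_real, Real.norm_of_nonneg (by linarith),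
          le_div_iff₀ (by linarith), ← norm_sum_conj_cpow]
        have : P i t = ∑ n ∈ Finset.Ioc N' (2 * N'), B n * (n : ℂ) ^ (-((t : ℂ) * I)) := by
          rw [hP]; dsimp only; rw [h2N']
        rw [← this]
        calc V'' * Bd = V' := by rw [hV'', hV']; field_simp
          _ ≤ ‖P i t‖ := hPi
      have hWmem : ∀ t ∈ Wi i, 0 ≤ t ∧ t ≤ T := fun t ht ↦ hW t (hWi_sub i ht)
      have hWsep : ∀ t ∈ Wi i, ∀ t' ∈ Wi i, t ≠ t' → 1 ≤ |t - t'| :=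
        fun t ht t' ht' hne ↦ hsep t (hWi_sub i ht) t' (hWi_sub i ht') hne
      have hN'T : ((N' : ℕ) : ℝ) ≤ T ^ 2 := hN'le.trans hMT
      have h := hL N' T V'' b' (Wi i) hN'1 hT hN'T hV''0 hb'1 hWmem hWsep hlarge'
      refine h.trans ?_
      have hCT : 0 ≤ C_L * T ^ ε₁ := by positivity
      have hN'0 : (0 : ℝ) ≤ N' := Nat.cast_nonneg _
      gcongr
    calc (W.card : ℝ) ≤ ∑ i ∈ Finset.range k, ((Wi i).card : ℝ) := hcard_le
      _ ≤ ∑ i ∈ Finset.range k, C_L * T ^ ε₁ *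
          (((M : ℝ) ^ k * 2 ^ k) ^ 2 * (V₂ ^ k / (k * Bd))⁻¹ ^ 2 +
            ((M : ℝ) ^ k * 2 ^ k) ^ (18 / 5 : ℝ) * (V₂ ^ k / (k * Bd))⁻¹ ^ 4 +
            T * ((M : ℝ) ^ k * 2 ^ k) ^ (12 / 5 : ℝ) * (V₂ ^ k / (k * Bd))⁻¹ ^ 4) :=
          Finset.sum_le_sum hbound
      _ = _ := by rw [Finset.sum_const, Finset.card_range, nsmul_eq_mul]
  · -- the mean value theorem on each block
    have hbound : ∀ i ∈ Finset.range k, ((Wi i).card : ℝ) ≤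
        72 * (T + 2 * ((M : ℝ) ^ k * 2 ^ k)) * Real.log (4 * ((M : ℝ) ^ k * 2 ^ k)) *
          ((M : ℝ) ^ k * 2 ^ k) * Bd ^ 2 * ((k : ℝ) / V₂ ^ k) ^ 2 := by
      intro i hi
      obtain ⟨hN'1, hN'le, h2N', h2N'le⟩ := hblock i hi
      set N' : ℕ := Mk * 2 ^ i with hN'
      set a : ℕ → ℂ := fun n ↦ if N' < n then B n else 0 with ha
      have hWmem : ∀ t ∈ Wi i, |t| ≤ T := fun t ht ↦ by
        obtain ⟨h0, h1⟩ := hW t (hWi_sub i ht); rw [abs_of_nonneg h0]; exact h1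
      have hWsep : ∀ t ∈ Wi i, ∀ t' ∈ Wi i, t ≠ t' → 1 ≤ |t - t'| :=
        fun t ht t' ht' hne ↦ hsep t (hWi_sub i ht) t' (hWi_sub i ht') hne
      have hMV := sum_norm_sq_dirichletPoly_le (2 * N') a T (Wi i) (by omega) hT1 hWmem hWsep
      -- identify the polynomial with `P i`
      have hpoly : ∀ t : ℝ, ∑ n ∈ Finset.Icc 1 (2 * N'), a n * (n : ℂ) ^ (-((t : ℂ) * I)) = P i t := by
        intro t
        have hfilter : (Finset.Icc 1 (2 * N')).filter (fun n ↦ N' < n) = Finset.Ioc N' (2 * N') := by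
          ext n; simp only [Finset.mem_filter, Finset.mem_Icc, Finset.mem_Ioc]; omega
        rw [hP]; dsimp only
        rw [← h2N', ← hfilter, Finset.sum_filter]
        refine Finset.sum_congr rfl fun n _ ↦ ?_
        rw [ha]; dsimp only
        split_ifs <;> simp
      -- the coefficient sum
      have hcoef : ∑ n ∈ Finset.Icc 1 (2 * N'), ‖a n‖ ^ 2 ≤ (N' : ℝ) * Bd ^ 2 := by
        have hfilter : (Finset.Icc 1 (2 * N')).filter (fun n ↦ N' < n) = Finset.Ioc N' (2 * N') := by
          ext n; simp only [Finset.mem_filter, Finset.mem_Icc, Finset.mem_Ioc]; omega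
        have e : ∑ n ∈ Finset.Icc 1 (2 * N'), ‖a n‖ ^ 2 =
            ∑ n ∈ Finset.Ioc N' (2 * N'), ‖B n‖ ^ 2 := by
          rw [← hfilter, Finset.sum_filter]
          refine Finset.sum_congr rfl fun n _ ↦ ?_
          rw [ha]; dsimp only
          split_ifs <;> simp
        rw [e]
        calc ∑ n ∈ Finset.Ioc N' (2 * N'), ‖B n‖ ^ 2 ≤ ∑ n ∈ Finset.Ioc N' (2 * N'), Bd ^ 2 := by
              refine Finset.sum_le_sum fun n hn ↦ ?_
              rw [Finset.mem_Ioc] at hn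
              exact pow_le_pow_left₀ (norm_nonneg _) (hBnorm n (by omega) (by omega)) 2
          _ = (N' : ℝ) * Bd ^ 2 := by
              rw [Finset.sum_const, nsmul_eq_mul, Nat.card_Ioc, show 2 * N' - N' = N' by omega]
      -- lower bound of the left side
      have hlow : ((Wi i).card : ℝ) * V' ^ 2 ≤
          ∑ t ∈ Wi i, ‖∑ n ∈ Finset.Icc 1 (2 * N'), a n * (n : ℂ) ^ (-((t : ℂ) * I))‖ ^ 2 := by
        rw [Finset.card_eq_sum_ones, Nat.cast_sum, Finset.sum_mul]
        refine Finset.sum_le_sum fun t ht ↦ ?_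
        rw [hpoly t, Nat.cast_one, one_mul]
        have := (Finset.mem_filter.1 (by rw [hWi] at ht; exact ht)).2
        exact pow_le_pow_left₀ hV'0.le this 2
      -- combine
      have hcomb : ((Wi i).card : ℝ) * V' ^ 2 ≤
          72 * (T + (2 * N' : ℕ)) * Real.log (2 * (2 * N' : ℕ)) * ((N' : ℝ) * Bd ^ 2) := by
        refine hlow.trans (hMV.trans ?_)
        refine mul_le_mul_of_nonneg_left hcoef ?_
        have : (1 : ℝ) ≤ 2 * (2 * N' : ℕ) := by push_cast; linarith [show (1:ℝ) ≤ N' by exact_mod_cast hN'1]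
        have := Real.log_nonneg this
        positivity
      have hN'R1 : (1 : ℝ) ≤ N' := by exact_mod_cast hN'1
      have hlogle : Real.log (2 * (2 * N' : ℕ)) ≤ Real.log (4 * ((M : ℝ) ^ k * 2 ^ k)) := by
        refine Real.log_le_log (by push_cast; positivity) ?_
        push_cast; linarith
      have hlog0 : 0 ≤ Real.log (2 * (2 * N' : ℕ)) := Real.log_nonneg (by push_cast; linarith)
      have hlog0' : 0 ≤ Real.log (4 * ((M : ℝ) ^ k * 2 ^ k)) := hlog0.trans hlogle
      rw [← le_div_iff₀ (by positivity)] at hcomb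
      have hTN : 72 * (T + (2 * N' : ℕ)) ≤ 72 * (T + 2 * ((M : ℝ) ^ k * 2 ^ k)) := by
        push_cast; linarith
      have hT2N : 0 ≤ 72 * (T + (2 * N' : ℕ)) := by positivity
      have hXY : 72 * (T + (2 * N' : ℕ)) * Real.log (2 * (2 * N' : ℕ)) * ((N' : ℝ) * Bd ^ 2) ≤
          72 * (T + 2 * ((M : ℝ) ^ k * 2 ^ k)) * Real.log (4 * ((M : ℝ) ^ k * 2 ^ k)) *
            (((M : ℝ) ^ k * 2 ^ k) * Bd ^ 2) := by
        refine mul_le_mul (mul_le_mul hTN hlogle hlog0 (by positivity)) ?_ (by positivity)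
          (by positivity)
        exact mul_le_mul_of_nonneg_right hN'le (by positivity)
      have hV₂k : V₂ ^ k ≠ 0 := by positivity
      have hkne' : (k : ℝ) ≠ 0 := hk0.ne'
      calc ((Wi i).card : ℝ)
          ≤ 72 * (T + (2 * N' : ℕ)) * Real.log (2 * (2 * N' : ℕ)) * ((N' : ℝ) * Bd ^ 2) / V' ^ 2 := hcomb
        _ ≤ 72 * (T + 2 * ((M : ℝ) ^ k * 2 ^ k)) * Real.log (4 * ((M : ℝ) ^ k * 2 ^ k)) *
            (((M : ℝ) ^ k * 2 ^ k) * Bd ^ 2) / V' ^ 2 := div_le_div_of_nonneg_right hXY (by positivity)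
        _ = _ := by rw [hV']; field_simp
    calc (W.card : ℝ) ≤ ∑ i ∈ Finset.range k, ((Wi i).card : ℝ) := hcard_le
      _ ≤ ∑ i ∈ Finset.range k, 72 * (T + 2 * ((M : ℝ) ^ k * 2 ^ k)) *
          Real.log (4 * ((M : ℝ) ^ k * 2 ^ k)) * ((M : ℝ) ^ k * 2 ^ k) * Bd ^ 2 *
          ((k : ℝ) / V₂ ^ k) ^ 2 := Finset.sum_le_sum hbound
      _ = _ := by rw [Finset.sum_const, Finset.card_range, nsmul_eq_mul]


/-! ## §6. One block, one Taylor index: the bound `≪ T^{15(1−σ)/(3+5σ)}` -/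

/-- Powers of `Q^{-σ}` against powers of `Q`: `Q^a (Q^{-σ})^n = Q^{a − nσ}` (`Q > 0`). [folklore] -/
theorem rpow_mul_rpow_neg_pow {Q : ℝ} (hQ : 0 < Q) (a σ : ℝ) (n : ℕ) :
    Q ^ a * (Q ^ (-σ)) ^ n = Q ^ (a - n * σ) := by
  rw [← Real.rpow_mul_natCast hQ.le, ← Real.rpow_add hQ]; congr 1; ring

/-- **The count on one block** (Guth–Maynard §13.1, fourth and fifth paragraphs, for ONE block
`(M, 2M]` and ONE set of fixed coefficients). Let `7/10 ≤ σ ≤ 4/5`, `T ≥ 2` with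
`2⁷⁷ T^{15/13} ≤ T²`, and let `Λ ≥ 1` dominate the bookkeeping quantities: `C_L T^{ε₁} ≤ Λ`,
`log(4T²) ≤ Λ`, `d(m)⁷⁷ ≤ Λ` for `m ≤ T²`. Let `T^{1/100} ≤ M`, `M² ≤ T^{15/(6+10σ)}`,
`|e_n| ≤ Λ² M^{-σ}`, and let `W ⊂ [0, T]` be `1`-separated with
`|∑_{M<n≤2M} e_n n^{-it}| ≥ V₁` on `W`, `V₁ Λ³ ≥ 1`. If the large values statement `hL`
(Guth–Maynard's Theorem 1.1 at exponent `ε₁` with constant `C_L`, lengths `N ≤ T²`) holds, then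
`|W| ≤ 16¹⁰⁰ Λ¹⁵⁴⁵ T^{15(1−σ)/(3+5σ)}`: choose `k` with `T^{10/(6+10σ)} ≤ M^k ≤ T^{15/(6+10σ)}`
(`k_choice`), count by `card_le_of_power`, and compare exponents by `case_bounds` according as
`M^k ≤ T^α` (Theorem 1.1) or `M^k > T^α` (mean value theorem).
[cite: GuthMaynard2024, §13.1 (proof of Thm. 1.2, eq. (13.1) to the end)] -/
theorem block_bound {C_L ε₁ : ℝ} (hCL : 0 ≤ C_L)
    (hL : ∀ (N : ℕ) (T V : ℝ) (b : ℕ → ℂ) (W : Finset ℝ), 1 ≤ N → 2 ≤ T → (N : ℝ) ≤ T ^ 2 →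
      0 < V → (∀ n, ‖b n‖ ≤ 1) → (∀ t ∈ W, 0 ≤ t ∧ t ≤ T) →
      (∀ t ∈ W, ∀ t' ∈ W, t ≠ t' → 1 ≤ |t - t'|) →
      (∀ t ∈ W, V ≤ ‖∑ n ∈ Finset.Icc N (2 * N), b n * (n : ℂ) ^ ((t : ℂ) * I)‖) →
      (W.card : ℝ) ≤ C_L * T ^ ε₁ * ((N : ℝ) ^ 2 * V⁻¹ ^ 2 + (N : ℝ) ^ (18 / 5 : ℝ) * V⁻¹ ^ 4 +
        T * (N : ℝ) ^ (12 / 5 : ℝ) * V⁻¹ ^ 4))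
    {σ : ℝ} (h₀ : 7 / 10 ≤ σ) (h₁ : σ ≤ 4 / 5) {T : ℝ} (hT : 2 ≤ T)
    (hT2 : (2 : ℝ) ^ 77 * T ^ (15 / 13 : ℝ) ≤ T ^ 2)
    {Λ : ℝ} (hΛ : 1 ≤ Λ) (hLT : C_L * T ^ ε₁ ≤ Λ) (hlog : Real.log (4 * T ^ 2) ≤ Λ)
    (hdpow : ∀ m : ℕ, 1 ≤ m → (m : ℝ) ≤ T ^ 2 → ((m.divisors.card : ℝ)) ^ 77 ≤ Λ)
    {M : ℕ} (hMX : T ^ (1 / 100 : ℝ) ≤ M) (hM2 : (M : ℝ) ^ 2 ≤ T ^ (15 / (6 + 10 * σ)))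
    (e : ℕ → ℂ) (he : ∀ n, ‖e n‖ ≤ Λ ^ 2 * (M : ℝ) ^ (-σ))
    (W : Finset ℝ) (hW : ∀ t ∈ W, 0 ≤ t ∧ t ≤ T)
    (hsep : ∀ t ∈ W, ∀ t' ∈ W, t ≠ t' → 1 ≤ |t - t'|) {V₁ : ℝ} (hV₁ : 1 ≤ V₁ * Λ ^ 3)
    (hlarge : ∀ t ∈ W, V₁ ≤ ‖∑ n ∈ Finset.Ioc M (2 * M), e n * (n : ℂ) ^ (-((t : ℂ) * I))‖) :
    (W.card : ℝ) ≤ 16 ^ 100 * Λ ^ 1545 * T ^ (15 * (1 - σ) / (3 + 5 * σ)) := by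
  -- basic sizes
  have hT1 : (1 : ℝ) < T := by linarith
  have hT0 : 0 < T := by linarith
  have hΛ0 : 0 < Λ := by linarith
  have hM1R : (1 : ℝ) < M := lt_of_lt_of_le (Real.one_lt_rpow hT1 (by norm_num)) hMX
  have hM0 : (0 : ℝ) < M := by linarith
  have hM : 1 ≤ M := by exact_mod_cast hM1R.le
  have hV₁0 : 0 < V₁ := by
    by_contra h; rw [not_lt] at h
    have : V₁ * Λ ^ 3 ≤ 0 := mul_nonpos_of_nonpos_of_nonneg h (by positivity)
    linarith
  obtain ⟨e1, e2, e3, e4, ha₁0, ha₁₂, ha₂le, -, hα0, hκ0, -⟩ := exponents h₀ h₁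
  -- the choice of `k`
  obtain ⟨k, hk1, hk77, hQ₁, hQ₂⟩ := k_choice h₀ hT1 hMX hM2
  have hk0 : (0 : ℝ) < k := by exact_mod_cast hk1
  set Q : ℝ := (M : ℝ) ^ k with hQdef
  have hQ0 : 0 < Q := by positivity
  -- `Q 2^k ≤ T²`
  have h2k : (2 : ℝ) ^ k ≤ 2 ^ 77 := pow_le_pow_right₀ (by norm_num) hk77
  have hQT : Q ≤ T ^ (15 / 13 : ℝ) := hQ₂.trans (Real.rpow_le_rpow_of_exponent_le hT1.le ha₂le)
  have hNkT : (M : ℝ) ^ k * 2 ^ k ≤ T ^ 2 := by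
    calc (M : ℝ) ^ k * 2 ^ k ≤ T ^ (15 / 13 : ℝ) * 2 ^ 77 :=
          mul_le_mul hQT h2k (by positivity) (by positivity)
      _ = 2 ^ 77 * T ^ (15 / 13 : ℝ) := by ring
      _ ≤ T ^ 2 := hT2
  -- normalised coefficients
  set E : ℝ := Λ ^ 2 * (M : ℝ) ^ (-σ) with hE
  have hE0 : 0 < E := by positivity
  set b : ℕ → ℂ := fun n ↦ e n / E with hb
  have hb1 : ∀ n, ‖b n‖ ≤ 1 := fun n ↦ by
    rw [hb]; dsimp only
    rw [norm_div, Complex.norm_real, Real.norm_of_nonneg hE0.le, div_le_one hE0]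
    exact he n
  set V₂ : ℝ := V₁ / E with hV₂
  have hV₂0 : 0 < V₂ := by positivity
  have hlarge' : ∀ t ∈ W, V₂ ≤ ‖∑ n ∈ Finset.Ioc M (2 * M), b n * (n : ℂ) ^ (-((t : ℂ) * I))‖ := by
    intro t ht
    have e : ∑ n ∈ Finset.Ioc M (2 * M), b n * (n : ℂ) ^ (-((t : ℂ) * I)) =
        (∑ n ∈ Finset.Ioc M (2 * M), e n * (n : ℂ) ^ (-((t : ℂ) * I))) / E := by
      rw [Finset.sum_div]
      exact Finset.sum_congr rfl fun n _ ↦ by rw [hb]; dsimp only; ring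
    rw [e, norm_div, Complex.norm_real, Real.norm_of_nonneg hE0.le, hV₂]
    exact div_le_div_of_nonneg_right (hlarge t ht) hE0.le
  -- the divisor bound for the power
  have hBd : ∀ m : ℕ, 1 ≤ m → m ≤ M ^ k * 2 ^ k → ((m.divisors.card : ℝ)) ^ k ≤ Λ := by
    intro m hm1 hm2
    have hm2R : (m : ℝ) ≤ ((M ^ k * 2 ^ k : ℕ) : ℝ) := by exact_mod_cast hm2
    have hmT : (m : ℝ) ≤ T ^ 2 := hm2R.trans (by push_cast; exact hNkT)
    have hd1 : (1 : ℝ) ≤ m.divisors.card := by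
      exact_mod_cast Finset.card_pos.2 ⟨1, Nat.one_mem_divisors.2 (by omega)⟩
    exact (pow_le_pow_right₀ hd1 hk77).trans (hdpow m hm1 hmT)
  obtain ⟨hLVb, hMVb⟩ := card_le_of_power hCL hL hT hk1 hM hNkT b hb1 hΛ hBd W hW hsep hV₂0 hlarge'
  -- `V₂^k ≥ Q^σ Λ^{-5k}`, i.e. `(V₂^k)⁻¹ ≤ Λ^{5k} Q^{-σ}`
  have hV₂k : (V₂ ^ k)⁻¹ ≤ Λ ^ (5 * k) * Q ^ (-σ) := by
    -- `V₂ = V₁ M^σ / Λ²`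
    have hV₂eq : V₂ = V₁ * (M : ℝ) ^ σ / Λ ^ 2 := by
      rw [hV₂, hE, Real.rpow_neg hM0.le]; field_simp
    have hV₁ge : (Λ ^ 3)⁻¹ ≤ V₁ := by
      calc (Λ ^ 3)⁻¹ = 1 / Λ ^ 3 := inv_eq_one_div _
        _ ≤ V₁ * Λ ^ 3 / Λ ^ 3 := div_le_div_of_nonneg_right hV₁ (by positivity)
        _ = V₁ := by field_simp
    -- lower bound for `V₂`
    have hV₂ge : (M : ℝ) ^ σ / Λ ^ 5 ≤ V₂ := by
      rw [hV₂eq]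
      calc (M : ℝ) ^ σ / Λ ^ 5 = (Λ ^ 3)⁻¹ * (M : ℝ) ^ σ / Λ ^ 2 := by field_simp
        _ ≤ V₁ * (M : ℝ) ^ σ / Λ ^ 2 := by gcongr
    have hpow : ((M : ℝ) ^ σ / Λ ^ 5) ^ k ≤ V₂ ^ k := pow_le_pow_left₀ (by positivity) hV₂ge k
    have hlhs : ((M : ℝ) ^ σ / Λ ^ 5) ^ k = Q ^ σ / Λ ^ (5 * k) := by
      rw [div_pow, ← pow_mul, hQdef, ← Real.rpow_mul_natCast hM0.le, ← Real.rpow_natCast_mul hM0.le,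
        mul_comm σ]
    rw [hlhs] at hpow
    have hQσ : 0 < Q ^ σ := Real.rpow_pos_of_pos hQ0 σ
    calc (V₂ ^ k)⁻¹ ≤ (Q ^ σ / Λ ^ (5 * k))⁻¹ := by
          rw [inv_le_inv₀ (by positivity) (by positivity)]; exact hpow
      _ = Λ ^ (5 * k) * Q ^ (-σ) := by rw [inv_div, Real.rpow_neg hQ0.le]; ring
  -- the inverse of `V' = V₂^k/(kΛ)`
  set ν : ℝ := (V₂ ^ k / (k * Λ))⁻¹ with hν
  have hν0 : 0 ≤ ν := by positivity
  have hνle : ν ≤ k * Λ ^ (1 + 5 * k) * Q ^ (-σ) := by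
    rw [hν, inv_div, div_eq_mul_inv]
    calc k * Λ * (V₂ ^ k)⁻¹ ≤ k * Λ * (Λ ^ (5 * k) * Q ^ (-σ)) :=
          mul_le_mul_of_nonneg_left hV₂k (by positivity)
      _ = k * Λ ^ (1 + 5 * k) * Q ^ (-σ) := by rw [pow_add, pow_one]; ring
  have hQσ0 : 0 ≤ Q ^ (-σ) := Real.rpow_nonneg hQ0.le _
  have hν2 : ν ^ 2 ≤ (k : ℝ) ^ 2 * Λ ^ (2 + 10 * k) * (Q ^ (-σ)) ^ 2 := by
    calc ν ^ 2 ≤ (k * Λ ^ (1 + 5 * k) * Q ^ (-σ)) ^ 2 := pow_le_pow_left₀ hν0 hνle 2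
      _ = (k : ℝ) ^ 2 * Λ ^ (2 + 10 * k) * (Q ^ (-σ)) ^ 2 := by
          rw [mul_pow, mul_pow, ← pow_mul]; ring_nf
  have hν4 : ν ^ 4 ≤ (k : ℝ) ^ 4 * Λ ^ (4 + 20 * k) * (Q ^ (-σ)) ^ 4 := by
    calc ν ^ 4 ≤ (k * Λ ^ (1 + 5 * k) * Q ^ (-σ)) ^ 4 := pow_le_pow_left₀ hν0 hνle 4
      _ = (k : ℝ) ^ 4 * Λ ^ (4 + 20 * k) * (Q ^ (-σ)) ^ 4 := by
          rw [mul_pow, mul_pow, ← pow_mul]; ring_nf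
  -- the power dictionary
  have hQ2 : Q ^ 2 * (Q ^ (-σ)) ^ 2 = Q ^ (2 - 2 * σ) := by
    rw [show Q ^ 2 = Q ^ (2 : ℝ) by rw [← Real.rpow_natCast]; norm_num, rpow_mul_rpow_neg_pow hQ0]
    norm_num
  have hQ1 : Q * (Q ^ (-σ)) ^ 2 = Q ^ (1 - 2 * σ) := by
    have h := rpow_mul_rpow_neg_pow hQ0 1 σ 2
    rw [Real.rpow_one] at h
    rw [h]; norm_num
  have hQ185 : Q ^ (18 / 5 : ℝ) * (Q ^ (-σ)) ^ 4 = Q ^ (18 / 5 - 4 * σ) := by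
    rw [rpow_mul_rpow_neg_pow hQ0]; norm_num
  have hQ125 : Q ^ (12 / 5 : ℝ) * (Q ^ (-σ)) ^ 4 = Q ^ (12 / 5 - 4 * σ) := by
    rw [rpow_mul_rpow_neg_pow hQ0]; norm_num
  -- `(2^k)^{18/5}, (2^k)^{12/5} ≤ 16^k`, `k ≤ 77`, `Λ`-powers
  have h2k1 : (1 : ℝ) ≤ 2 ^ k := one_le_pow₀ (by norm_num)
  have h16 : ((2 : ℝ) ^ k) ^ (18 / 5 : ℝ) ≤ 16 ^ k := by
    calc ((2 : ℝ) ^ k) ^ (18 / 5 : ℝ) ≤ ((2 : ℝ) ^ k) ^ (4 : ℝ) :=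
          Real.rpow_le_rpow_of_exponent_le h2k1 (by norm_num)
      _ = 16 ^ k := by
          rw [show (4 : ℝ) = ((4 : ℕ) : ℝ) by norm_num, Real.rpow_natCast, ← pow_mul, pow_mul']
          norm_num
  have h16' : ((2 : ℝ) ^ k) ^ (12 / 5 : ℝ) ≤ 16 ^ k := by
    calc ((2 : ℝ) ^ k) ^ (12 / 5 : ℝ) ≤ ((2 : ℝ) ^ k) ^ (4 : ℝ) :=
          Real.rpow_le_rpow_of_exponent_le h2k1 (by norm_num)
      _ = 16 ^ k := by
          rw [show (4 : ℝ) = ((4 : ℕ) : ℝ) by norm_num, Real.rpow_natCast, ← pow_mul, pow_mul']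
          norm_num
  have h4_16 : ((2 : ℝ) ^ k) ^ 2 ≤ 16 ^ k := by
    rw [← pow_mul, pow_mul']; exact pow_le_pow_left₀ (by norm_num) (by norm_num) k
  have hk77R : (k : ℝ) ≤ 77 := by exact_mod_cast hk77
  have hκT : 0 < T ^ (15 * (1 - σ) / (3 + 5 * σ)) := Real.rpow_pos_of_pos hT0 _
  -- the case bounds
  obtain ⟨hc1, hcLV, hcMV⟩ := case_bounds h₀ h₁ hT1.le hQ0 hQ₁ hQ₂
  -- final constants
  have hconst1 : (3 : ℝ) * (77 : ℝ) ^ 5 * 16 ^ 77 ≤ 16 ^ 100 := by norm_num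
  have hconst2 : (288 : ℝ) * (77 : ℝ) ^ 3 * 4 ^ 77 ≤ 16 ^ 100 := by norm_num
  have hΛ5 : Λ ^ (5 + 20 * k) = Λ ^ (4 + 20 * k) * Λ := by rw [← pow_succ]; ring_nf
  have hΛ3 : Λ ^ (3 + 10 * k) = Λ ^ (10 * k) * Λ ^ 2 * Λ := by
    rw [← pow_add, ← pow_succ]; ring_nf
  have hΛpow : ∀ {a b : ℕ}, a ≤ b → Λ ^ a ≤ Λ ^ b := fun hab ↦ pow_le_pow_right₀ hΛ hab
  rcases le_total Q (T ^ (75 * (1 - σ) / ((3 + 5 * σ) * (18 - 20 * σ)))) with hQα | hQα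
  · -- Theorem 1.1 branch
    obtain ⟨hc2, hc3⟩ := hcLV hQα
    have hCT : C_L * T ^ ε₁ ≤ Λ := hLT
    -- the three terms
    have ht1 : ((M : ℝ) ^ k * 2 ^ k) ^ 2 * ν ^ 2 ≤
        (k : ℝ) ^ 2 * 16 ^ k * Λ ^ (2 + 10 * k) * T ^ (15 * (1 - σ) / (3 + 5 * σ)) := by
      calc ((M : ℝ) ^ k * 2 ^ k) ^ 2 * ν ^ 2
          ≤ (Q ^ 2 * ((2 : ℝ) ^ k) ^ 2) * ((k : ℝ) ^ 2 * Λ ^ (2 + 10 * k) * (Q ^ (-σ)) ^ 2) := by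
            rw [mul_pow]; exact mul_le_mul_of_nonneg_left hν2 (by positivity)
        _ = (k : ℝ) ^ 2 * ((2 : ℝ) ^ k) ^ 2 * Λ ^ (2 + 10 * k) * (Q ^ 2 * (Q ^ (-σ)) ^ 2) := by ring
        _ ≤ (k : ℝ) ^ 2 * 16 ^ k * Λ ^ (2 + 10 * k) * T ^ (15 * (1 - σ) / (3 + 5 * σ)) := by
            rw [hQ2]; gcongr
    have ht2 : ((M : ℝ) ^ k * 2 ^ k) ^ (18 / 5 : ℝ) * ν ^ 4 ≤
        (k : ℝ) ^ 4 * 16 ^ k * Λ ^ (4 + 20 * k) * T ^ (15 * (1 - σ) / (3 + 5 * σ)) := by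
      calc ((M : ℝ) ^ k * 2 ^ k) ^ (18 / 5 : ℝ) * ν ^ 4
          ≤ (Q ^ (18 / 5 : ℝ) * ((2 : ℝ) ^ k) ^ (18 / 5 : ℝ)) *
              ((k : ℝ) ^ 4 * Λ ^ (4 + 20 * k) * (Q ^ (-σ)) ^ 4) := by
            rw [Real.mul_rpow hQ0.le (by positivity)]
            exact mul_le_mul_of_nonneg_left hν4 (by positivity)
        _ = (k : ℝ) ^ 4 * ((2 : ℝ) ^ k) ^ (18 / 5 : ℝ) * Λ ^ (4 + 20 * k) *
              (Q ^ (18 / 5 : ℝ) * (Q ^ (-σ)) ^ 4) := by ring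
        _ ≤ (k : ℝ) ^ 4 * 16 ^ k * Λ ^ (4 + 20 * k) * T ^ (15 * (1 - σ) / (3 + 5 * σ)) := by
            rw [hQ185]; gcongr
    have ht3 : T * ((M : ℝ) ^ k * 2 ^ k) ^ (12 / 5 : ℝ) * ν ^ 4 ≤
        (k : ℝ) ^ 4 * 16 ^ k * Λ ^ (4 + 20 * k) * T ^ (15 * (1 - σ) / (3 + 5 * σ)) := by
      calc T * ((M : ℝ) ^ k * 2 ^ k) ^ (12 / 5 : ℝ) * ν ^ 4
          ≤ T * (Q ^ (12 / 5 : ℝ) * ((2 : ℝ) ^ k) ^ (12 / 5 : ℝ)) *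
              ((k : ℝ) ^ 4 * Λ ^ (4 + 20 * k) * (Q ^ (-σ)) ^ 4) := by
            rw [Real.mul_rpow hQ0.le (by positivity)]
            exact mul_le_mul_of_nonneg_left hν4 (by positivity)
        _ = (k : ℝ) ^ 4 * ((2 : ℝ) ^ k) ^ (12 / 5 : ℝ) * Λ ^ (4 + 20 * k) *
              (T * (Q ^ (12 / 5 : ℝ) * (Q ^ (-σ)) ^ 4)) := by ring
        _ ≤ (k : ℝ) ^ 4 * 16 ^ k * Λ ^ (4 + 20 * k) * T ^ (15 * (1 - σ) / (3 + 5 * σ)) := by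
            rw [hQ125]; gcongr
    -- collect
    have hk2 : (k : ℝ) ^ 2 ≤ (k : ℝ) ^ 4 := pow_le_pow_right₀ (by exact_mod_cast hk1) (by norm_num)
    have hΛ24 : Λ ^ (2 + 10 * k) ≤ Λ ^ (4 + 20 * k) := hΛpow (by omega)
    have hsum : ((M : ℝ) ^ k * 2 ^ k) ^ 2 * ν ^ 2 + ((M : ℝ) ^ k * 2 ^ k) ^ (18 / 5 : ℝ) * ν ^ 4 +
        T * ((M : ℝ) ^ k * 2 ^ k) ^ (12 / 5 : ℝ) * ν ^ 4 ≤
        3 * ((k : ℝ) ^ 4 * 16 ^ k * Λ ^ (4 + 20 * k) * T ^ (15 * (1 - σ) / (3 + 5 * σ))) := by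
      have ht1' : ((M : ℝ) ^ k * 2 ^ k) ^ 2 * ν ^ 2 ≤
          (k : ℝ) ^ 4 * 16 ^ k * Λ ^ (4 + 20 * k) * T ^ (15 * (1 - σ) / (3 + 5 * σ)) :=
        ht1.trans (by gcongr)
      linarith
    calc (W.card : ℝ) ≤ _ := hLVb
      _ ≤ k * (Λ * (3 * ((k : ℝ) ^ 4 * 16 ^ k * Λ ^ (4 + 20 * k) *
          T ^ (15 * (1 - σ) / (3 + 5 * σ))))) := by
          refine mul_le_mul_of_nonneg_left ?_ hk0.le
          exact mul_le_mul hCT hsum (by positivity) hΛ0.le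
      _ = 3 * (k : ℝ) ^ 5 * 16 ^ k * Λ ^ (5 + 20 * k) * T ^ (15 * (1 - σ) / (3 + 5 * σ)) := by
          rw [hΛ5]; ring
      _ ≤ 3 * (77 : ℝ) ^ 5 * 16 ^ 77 * Λ ^ 1545 * T ^ (15 * (1 - σ) / (3 + 5 * σ)) := by
          gcongr
          all_goals first | exact hk77R | exact hk77 | omega | norm_num
      _ ≤ 16 ^ 100 * Λ ^ 1545 * T ^ (15 * (1 - σ) / (3 + 5 * σ)) := by
          have := mul_le_mul_of_nonneg_right hconst1
            (by positivity : 0 ≤ Λ ^ 1545 * T ^ (15 * (1 - σ) / (3 + 5 * σ)))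
          linarith [this]
  · -- mean value theorem branch
    have hc4 := hcMV hQα
    have hlogNk : Real.log (4 * ((M : ℝ) ^ k * 2 ^ k)) ≤ Λ :=
      (Real.log_le_log (by positivity) (by linarith [hNkT])).trans hlog
    have hV₂2 : ((k : ℝ) / V₂ ^ k) ^ 2 ≤ (k : ℝ) ^ 2 * Λ ^ (10 * k) * (Q ^ (-σ)) ^ 2 := by
      rw [div_pow, div_eq_mul_inv, ← inv_pow]
      calc (k : ℝ) ^ 2 * (V₂ ^ k)⁻¹ ^ 2 ≤ (k : ℝ) ^ 2 * (Λ ^ (5 * k) * Q ^ (-σ)) ^ 2 :=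
            mul_le_mul_of_nonneg_left (pow_le_pow_left₀ (by positivity) hV₂k 2) (by positivity)
        _ = (k : ℝ) ^ 2 * Λ ^ (10 * k) * (Q ^ (-σ)) ^ 2 := by rw [mul_pow, ← pow_mul]; ring_nf
    have hmain : (T + 2 * ((M : ℝ) ^ k * 2 ^ k)) * ((M : ℝ) ^ k * 2 ^ k) * ((k : ℝ) / V₂ ^ k) ^ 2 ≤
        (k : ℝ) ^ 2 * Λ ^ (10 * k) * (2 * 4 ^ k) * (2 * T ^ (15 * (1 - σ) / (3 + 5 * σ))) := by
      calc (T + 2 * ((M : ℝ) ^ k * 2 ^ k)) * ((M : ℝ) ^ k * 2 ^ k) * ((k : ℝ) / V₂ ^ k) ^ 2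
          ≤ (T + 2 * (Q * 2 ^ k)) * (Q * 2 ^ k) * ((k : ℝ) ^ 2 * Λ ^ (10 * k) * (Q ^ (-σ)) ^ 2) :=
            mul_le_mul_of_nonneg_left hV₂2 (by positivity)
        _ = (k : ℝ) ^ 2 * Λ ^ (10 * k) * (2 ^ k * (T * (Q * (Q ^ (-σ)) ^ 2)) +
              2 * (2 ^ k) ^ 2 * (Q ^ 2 * (Q ^ (-σ)) ^ 2)) := by ring
        _ = (k : ℝ) ^ 2 * Λ ^ (10 * k) * (2 ^ k * (T * Q ^ (1 - 2 * σ)) +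
              2 * (2 ^ k) ^ 2 * Q ^ (2 - 2 * σ)) := by rw [hQ1, hQ2]
        _ ≤ (k : ℝ) ^ 2 * Λ ^ (10 * k) * (2 ^ k * T ^ (15 * (1 - σ) / (3 + 5 * σ)) +
              2 * (2 ^ k) ^ 2 * T ^ (15 * (1 - σ) / (3 + 5 * σ))) := by gcongr
        _ ≤ (k : ℝ) ^ 2 * Λ ^ (10 * k) * (2 * 4 ^ k) * (2 * T ^ (15 * (1 - σ) / (3 + 5 * σ))) := by
            have h2le4 : (2 : ℝ) ^ k ≤ 4 ^ k := pow_le_pow_left₀ (by norm_num) (by norm_num) k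
            have h44 : ((2 : ℝ) ^ k) ^ 2 = 4 ^ k := by rw [← pow_mul, pow_mul']; norm_num
            have hx : 2 ^ k * T ^ (15 * (1 - σ) / (3 + 5 * σ)) +
                2 * (2 ^ k) ^ 2 * T ^ (15 * (1 - σ) / (3 + 5 * σ)) ≤
                (2 * 4 ^ k) * (2 * T ^ (15 * (1 - σ) / (3 + 5 * σ))) := by
              rw [h44]
              have h1 := mul_le_mul_of_nonneg_right h2le4 hκT.le
              have h2 : (0 : ℝ) ≤ 4 ^ k * T ^ (15 * (1 - σ) / (3 + 5 * σ)) := by positivity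
              linarith
            calc _ ≤ (k : ℝ) ^ 2 * Λ ^ (10 * k) * ((2 * 4 ^ k) * (2 * T ^ (15 * (1 - σ) / (3 + 5 * σ)))) :=
                  mul_le_mul_of_nonneg_left hx (by positivity)
              _ = _ := by ring
    calc (W.card : ℝ) ≤ _ := hMVb
      _ = k * (72 * Real.log (4 * ((M : ℝ) ^ k * 2 ^ k)) * Λ ^ 2 *
          ((T + 2 * ((M : ℝ) ^ k * 2 ^ k)) * ((M : ℝ) ^ k * 2 ^ k) * ((k : ℝ) / V₂ ^ k) ^ 2)) := by
          ring
      _ ≤ k * (72 * Λ * Λ ^ 2 *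
          ((k : ℝ) ^ 2 * Λ ^ (10 * k) * (2 * 4 ^ k) * (2 * T ^ (15 * (1 - σ) / (3 + 5 * σ))))) := by
          gcongr
      _ = 288 * (k : ℝ) ^ 3 * 4 ^ k * Λ ^ (3 + 10 * k) * T ^ (15 * (1 - σ) / (3 + 5 * σ)) := by
          rw [hΛ3]; ring
      _ ≤ 288 * (77 : ℝ) ^ 3 * 4 ^ 77 * Λ ^ 1545 * T ^ (15 * (1 - σ) / (3 + 5 * σ)) := by
          gcongr
          all_goals first | exact hk77R | exact hk77 | omega | norm_num
      _ ≤ 16 ^ 100 * Λ ^ 1545 * T ^ (15 * (1 - σ) / (3 + 5 * σ)) := by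
          have := mul_le_mul_of_nonneg_right hconst2
            (by positivity : 0 ≤ Λ ^ 1545 * T ^ (15 * (1 - σ) / (3 + 5 * σ)))
          linarith [this]

/-! ## §7. The Type I count -/

set_option maxHeartbeats 800000 in
/-- **The Type I count** (Guth–Maynard §13.1, third to fifth paragraphs: "Thus it suffices to
bound the number of Type I zeros. There are `O(log T)` choices of `N` … we focus on the value of `N`
which gives the largest number of Type I zeros … if `ρ` is a Type I zero, we have
`|D(σ + iγ + iξ)| ≳ 1` … Thus it suffices to show that if `N < T^{1/2+o(1)}` and `W` is a
1-separated set in `[T, 2T]` such that `|D̃(t)| ≳ N^σ`, we have `|W| ≲ T^{15(1−σ)/(3+5σ)+o(1)}`",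
which is then shown from Theorem 1.1 and the mean value theorem). Let `7/10 ≤ σ ≤ 4/5`, `T ≥ 2`
with `2⁷⁷ T^{15/13} ≤ T²`, `Λ ≥ 6` dominating the bookkeeping (`C_L T^{ε₁}`, `log(4T²)`, `d(m)⁷⁷`
for `m ≤ T²`, the divisor constant, `(2N₀)^{η'}`, `J`, `J₁`), `T^{1/100} ≤ X`, `N₀ ≤ X 2^J`,
`N₀² ≤ T^{15/14}`, `48 (21/100)^{J₁} N₀ Λ³ ≤ 1`, `|c(n)| ≤ d(n)`. For a finite set `Z` of points
`ρ = β + iγ`, `σ ≤ β ≤ 1`, `0 ≤ γ ≤ T`, ordinates pairwise `≥ 1` apart, the number of `ρ ∈ Z` with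
`|∑_{X<n≤N₀} c(n) n^{-ρ}| > 1/3` is at most `16¹⁰⁰ Λ¹⁵⁴⁷ T^{15(1−σ)/(3+5σ)}`, GIVEN the large values
statement `hL` (Theorem 1.1 at exponent `ε₁`, constant `C_L`, lengths `N ≤ T²`): dyadic blocks
and pigeonhole (`HuxleyZeroDensity.exists_block_large`), removal of the real parts
(`beta_removal`) and pigeonhole over the Taylor index, then `block_bound` on the ordinates.
[cite: GuthMaynard2024, §13.1 (proof of Thm. 1.2, third paragraph to the end)] -/
theorem card_typeI_le {C_L ε₁ : ℝ} (hCL : 0 ≤ C_L)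
    (hL : ∀ (N : ℕ) (T V : ℝ) (b : ℕ → ℂ) (W : Finset ℝ), 1 ≤ N → 2 ≤ T → (N : ℝ) ≤ T ^ 2 →
      0 < V → (∀ n, ‖b n‖ ≤ 1) → (∀ t ∈ W, 0 ≤ t ∧ t ≤ T) →
      (∀ t ∈ W, ∀ t' ∈ W, t ≠ t' → 1 ≤ |t - t'|) →
      (∀ t ∈ W, V ≤ ‖∑ n ∈ Finset.Icc N (2 * N), b n * (n : ℂ) ^ ((t : ℂ) * I)‖) →
      (W.card : ℝ) ≤ C_L * T ^ ε₁ * ((N : ℝ) ^ 2 * V⁻¹ ^ 2 + (N : ℝ) ^ (18 / 5 : ℝ) * V⁻¹ ^ 4 +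
        T * (N : ℝ) ^ (12 / 5 : ℝ) * V⁻¹ ^ 4))
    {σ : ℝ} (h₀ : 7 / 10 ≤ σ) (h₁ : σ ≤ 4 / 5) {T : ℝ} (hT : 2 ≤ T)
    (hT2 : (2 : ℝ) ^ 77 * T ^ (15 / 13 : ℝ) ≤ T ^ 2)
    {Λ : ℝ} (hΛ : 6 ≤ Λ) (hLT : C_L * T ^ ε₁ ≤ Λ) (hlog : Real.log (4 * T ^ 2) ≤ Λ)
    (hdpow : ∀ m : ℕ, 1 ≤ m → (m : ℝ) ≤ T ^ 2 → ((m.divisors.card : ℝ)) ^ 77 ≤ Λ)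
    {η' : ℝ} (hη' : 0 ≤ η') (hd : ∀ n : ℕ, (n.divisors.card : ℝ) ≤ Λ * (n : ℝ) ^ η')
    {X N₀ J J₁ : ℕ} (hX : T ^ (1 / 100 : ℝ) ≤ X) (hXN : N₀ ≤ X * 2 ^ J)
    (hN₀2 : (N₀ : ℝ) ^ 2 ≤ T ^ (15 / 14 : ℝ)) (hN₀η : (2 * (N₀ : ℝ)) ^ η' ≤ Λ)
    (hJ : (J : ℝ) ≤ Λ) (hJ₁ : 1 ≤ J₁) (hJ₁Λ : (J₁ : ℝ) ≤ Λ)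
    (htail : 48 * (21 / 100 : ℝ) ^ J₁ * N₀ * Λ ^ 3 ≤ 1)
    (c : ℕ → ℂ) (hc : ∀ n, ‖c n‖ ≤ (n.divisors.card : ℝ))
    (Z : Finset ℂ) (hZ : ∀ ρ ∈ Z, σ ≤ ρ.re ∧ ρ.re ≤ 1 ∧ 0 ≤ ρ.im ∧ ρ.im ≤ T)
    (hsep : ∀ ρ ∈ Z, ∀ ρ' ∈ Z, ρ ≠ ρ' → 1 ≤ |ρ.im - ρ'.im|) :
    ((Z.filter (fun ρ ↦ 1 / 3 < ‖∑ n ∈ Finset.Ioc X N₀, c n * (n : ℂ) ^ (-ρ)‖)).card : ℝ) ≤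
      16 ^ 100 * Λ ^ 1547 * T ^ (15 * (1 - σ) / (3 + 5 * σ)) := by
  classical
  -- sizes
  have hT1 : (1 : ℝ) < T := by linarith
  have hT0 : 0 < T := by linarith
  have hΛ1 : 1 ≤ Λ := by linarith
  have hΛ0 : 0 < Λ := by linarith
  have hX1R : (1 : ℝ) < X := lt_of_lt_of_le (Real.one_lt_rpow hT1 (by norm_num)) hX
  have hX0 : (0 : ℝ) < X := by linarith
  have hX1 : 1 ≤ X := by exact_mod_cast hX1R.le
  obtain ⟨-, -, -, -, -, -, -, -, -, hκ0, -⟩ := exponents h₀ h₁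
  set κ : ℝ := 15 * (1 - σ) / (3 + 5 * σ) with hκ
  set R : ℝ := 16 ^ 100 * Λ ^ 1545 * T ^ κ with hR
  have hR0 : 0 ≤ R := by positivity
  -- `J ≥ 1` unless everything is empty
  rcases Nat.eq_zero_or_pos J with hJ0 | hJpos
  · -- `J = 0`: then `N₀ ≤ X`, the sum is empty, no Type I points
    subst hJ0
    have hempty : Z.filter (fun ρ ↦ 1 / 3 < ‖∑ n ∈ Finset.Ioc X N₀, c n * (n : ℂ) ^ (-ρ)‖) = ∅ := by
      rw [Finset.filter_eq_empty_iff]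
      intro ρ _
      have : Finset.Ioc X N₀ = ∅ := by
        rw [Finset.Ioc_eq_empty_iff]; simp at hXN; omega
      rw [this, Finset.sum_empty, norm_zero]; norm_num
    rw [hempty, Finset.card_empty, Nat.cast_zero]; positivity
  have hJ0R : (0 : ℝ) < J := by exact_mod_cast hJpos
  have hJ₁0R : (0 : ℝ) < J₁ := by exact_mod_cast hJ₁
  -- truncated coefficients and blocks
  set c' : ℕ → ℂ := fun n ↦ if n ≤ N₀ then c n else 0 with hc'def
  have hc' : ∀ n, ‖c' n‖ ≤ (n.divisors.card : ℝ) := by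
    intro n; rw [hc'def]; dsimp only
    split_ifs
    · exact hc n
    · simp
  set B : ℕ → ℂ → ℂ := fun i ρ ↦ ∑ n ∈ Finset.Ioc (X * 2 ^ i) (X * 2 ^ (i + 1)), c' n * (n : ℂ) ^ (-ρ)
    with hBdef
  have hsplit : ∀ ρ : ℂ, ∑ n ∈ Finset.Ioc X N₀, c n * (n : ℂ) ^ (-ρ) =
      ∑ i ∈ Finset.range J, B i ρ := by
    intro ρ
    have h1 : ∑ n ∈ Finset.Ioc X N₀, c n * (n : ℂ) ^ (-ρ) =
        ∑ n ∈ Finset.Ioc X (X * 2 ^ J), c' n * (n : ℂ) ^ (-ρ) := by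
      have hsub : Finset.Ioc X N₀ ⊆ Finset.Ioc X (X * 2 ^ J) := fun n hn ↦ by
        simp only [Finset.mem_Ioc] at hn ⊢; exact ⟨hn.1, hn.2.trans hXN⟩
      rw [← Finset.sum_subset hsub]
      · refine Finset.sum_congr rfl fun n hn ↦ ?_
        simp only [Finset.mem_Ioc] at hn
        rw [hc'def]; dsimp only; rw [if_pos hn.2]
      · intro n _ hn'
        simp only [Finset.mem_Ioc, not_and, not_le] at hn'
        rw [hc'def]; dsimp only
        rw [if_neg (by
          intro hle
          simp only [Finset.mem_Ioc] at *
          omega), zero_mul]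
    rw [h1, ZeroDensity.sum_Ioc_mul_two_pow]
  set V : ℝ := 1 / (3 * (J : ℝ)) with hV
  have hV0 : 0 < V := by positivity
  set Zi : ℕ → Finset ℂ := fun i ↦ Z.filter (fun ρ ↦ V ≤ ‖B i ρ‖) with hZi
  have hcover : Z.filter (fun ρ ↦ 1 / 3 < ‖∑ n ∈ Finset.Ioc X N₀, c n * (n : ℂ) ^ (-ρ)‖) ⊆
      (Finset.range J).biUnion Zi := by
    intro ρ hρ
    rw [Finset.mem_filter] at hρ
    rw [hsplit ρ] at hρ
    obtain ⟨i, hi, hlarge⟩ := HuxleyZeroDensity.exists_block_large hρ.2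
    rw [Finset.mem_biUnion]
    exact ⟨i, hi, by rw [hZi, Finset.mem_filter]; exact ⟨hρ.1, hlarge.le⟩⟩
  -- the bound for one block
  have hblock : ∀ i ∈ Finset.range J, ((Zi i).card : ℝ) ≤ J₁ * R := by
    intro i _
    set M : ℕ := X * 2 ^ i with hM
    have hM1 : 1 ≤ M := by rw [hM]; exact Nat.one_le_iff_ne_zero.2 (by positivity)
    have hM0 : (0 : ℝ) < M := by exact_mod_cast hM1
    have hblk : X * 2 ^ (i + 1) = 2 * M := by rw [hM]; ring
    by_cases hNM : N₀ ≤ M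
    · -- empty block
      have hempty : Zi i = ∅ := by
        rw [Finset.eq_empty_iff_forall_notMem]
        intro ρ hρ
        rw [hZi, Finset.mem_filter] at hρ
        have hB0 : B i ρ = 0 := by
          rw [hBdef]; dsimp only
          refine Finset.sum_eq_zero fun n hn ↦ ?_
          simp only [Finset.mem_Ioc] at hn
          rw [hc'def]; dsimp only
          rw [if_neg (by omega), zero_mul]
        rw [hB0, norm_zero] at hρ
        linarith [hρ.2]
      rw [hempty, Finset.card_empty, Nat.cast_zero]; positivity
    rw [not_le] at hNM
    -- sizes of the block
    have hMN : (M : ℝ) ≤ N₀ := by exact_mod_cast hNM.le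
    have hXM : (X : ℝ) ≤ M := by
      rw [hM]; push_cast
      exact le_mul_of_one_le_right hX0.le (one_le_pow₀ (by norm_num))
    have hMX : T ^ (1 / 100 : ℝ) ≤ M := hX.trans hXM
    have hM2 : (M : ℝ) ^ 2 ≤ T ^ (15 / (6 + 10 * σ)) := by
      calc (M : ℝ) ^ 2 ≤ (N₀ : ℝ) ^ 2 := pow_le_pow_left₀ hM0.le hMN 2
        _ ≤ T ^ (15 / 14 : ℝ) := hN₀2
        _ ≤ T ^ (15 / (6 + 10 * σ)) := by
            refine Real.rpow_le_rpow_of_exponent_le hT1.le ?_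
            rw [div_le_div_iff₀ (by norm_num) (by linarith)]; linarith
    have h2Mη : (2 * (M : ℝ)) ^ η' ≤ Λ :=
      (Real.rpow_le_rpow (by positivity) (by linarith) hη').trans hN₀η
    -- the coefficient sum of the block (for the Taylor tail)
    have hG₁ : ∑ n ∈ Finset.Ioc M (2 * M), ‖c' n‖ * (n : ℝ) ^ (-σ) ≤ (N₀ : ℝ) * Λ ^ 2 := by
      have hterm : ∀ n ∈ Finset.Ioc M (2 * M), ‖c' n‖ * (n : ℝ) ^ (-σ) ≤ Λ ^ 2 := by
        intro n hn
        rw [Finset.mem_Ioc] at hn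
        have hn0 : (0 : ℝ) < n := by exact_mod_cast (by omega : 0 < n)
        have hn1 : (1 : ℝ) ≤ n := by exact_mod_cast (by omega : 1 ≤ n)
        have h1 : ‖c' n‖ ≤ Λ * Λ := by
          calc ‖c' n‖ ≤ (n.divisors.card : ℝ) := hc' n
            _ ≤ Λ * (n : ℝ) ^ η' := hd n
            _ ≤ Λ * (2 * (M : ℝ)) ^ η' := by
                gcongr; exact_mod_cast hn.2
            _ ≤ Λ * Λ := mul_le_mul_of_nonneg_left h2Mη hΛ0.le
        have h2 : (n : ℝ) ^ (-σ) ≤ 1 := Real.rpow_le_one_of_one_le_of_nonpos hn1 (by linarith)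
        calc ‖c' n‖ * (n : ℝ) ^ (-σ) ≤ Λ * Λ * 1 :=
              mul_le_mul h1 h2 (Real.rpow_nonneg hn0.le _) (by positivity)
          _ = Λ ^ 2 := by ring
      calc ∑ n ∈ Finset.Ioc M (2 * M), ‖c' n‖ * (n : ℝ) ^ (-σ)
          ≤ ∑ n ∈ Finset.Ioc M (2 * M), Λ ^ 2 := Finset.sum_le_sum hterm
        _ = M * Λ ^ 2 := by
            rw [Finset.sum_const, nsmul_eq_mul, Nat.card_Ioc, show 2 * M - M = M by omega]
        _ ≤ (N₀ : ℝ) * Λ ^ 2 := mul_le_mul_of_nonneg_right hMN (by positivity)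
    have htail' : 2 * (21 / 100 : ℝ) ^ J₁ * ∑ n ∈ Finset.Ioc M (2 * M), ‖c' n‖ * (n : ℝ) ^ (-σ) ≤
        V / 2 := by
      have hVJ : 1 / (6 * Λ) ≤ V / 2 := by
        rw [hV, div_div, div_le_div_iff₀ (by positivity) (by positivity)]; nlinarith
      refine le_trans ?_ hVJ
      calc 2 * (21 / 100 : ℝ) ^ J₁ * ∑ n ∈ Finset.Ioc M (2 * M), ‖c' n‖ * (n : ℝ) ^ (-σ)
          ≤ 2 * (21 / 100 : ℝ) ^ J₁ * ((N₀ : ℝ) * Λ ^ 2) :=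
            mul_le_mul_of_nonneg_left hG₁ (by positivity)
        _ = (48 * (21 / 100 : ℝ) ^ J₁ * N₀ * Λ ^ 3) / (24 * Λ) := by field_simp; ring
        _ ≤ 1 / (24 * Λ) := div_le_div_of_nonneg_right htail (by positivity)
        _ ≤ 1 / (6 * Λ) := by
            rw [div_le_div_iff₀ (by positivity) (by positivity)]; nlinarith
    -- Taylor index classes
    set S : ℕ → ℂ → ℂ := fun j ρ ↦ ∑ n ∈ Finset.Ioc M (2 * M),
      c' n * (((n : ℝ) ^ (-σ) * Real.log ((n : ℝ) / M) ^ j : ℝ) : ℂ) * (n : ℂ) ^ (-((ρ.im : ℂ) * I))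
      with hSdef
    set V₁ : ℝ := V / (2 * J₁) with hV₁
    have hV₁0 : 0 < V₁ := by positivity
    set Zij : ℕ → Finset ℂ := fun j ↦ (Zi i).filter (fun ρ ↦ V₁ ≤ ‖S j ρ‖) with hZij
    have hcover' : Zi i ⊆ (Finset.range J₁).biUnion Zij := by
      intro ρ hρ
      have hρ' := hρ
      rw [hZi, Finset.mem_filter] at hρ'
      obtain ⟨hβ, hβ1, -, -⟩ := hZ ρ hρ'.1
      have hlargeB : V ≤ ‖∑ n ∈ Finset.Ioc M (2 * M), c' n * (n : ℂ) ^ (-ρ)‖ := by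
        have := hρ'.2
        rw [hBdef] at this; dsimp only at this
        rwa [hblk] at this
      obtain ⟨j, hj, hjlarge⟩ := beta_removal hM1 c' hβ (by linarith) hJ₁ hV0 hlargeB htail'
      rw [Finset.mem_biUnion]
      refine ⟨j, Finset.mem_range.2 hj, ?_⟩
      rw [hZij, Finset.mem_filter]
      exact ⟨hρ, by rw [hSdef, hV₁]; exact hjlarge⟩
    -- each Taylor class is counted by `block_bound` on the ordinates
    have hclass : ∀ j ∈ Finset.range J₁, ((Zij j).card : ℝ) ≤ R := by
      intro j _
      have hZij_sub : Zij j ⊆ Z := (Finset.filter_subset _ _).trans (Finset.filter_subset _ _)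
      -- the ordinates
      set W : Finset ℝ := (Zij j).image Complex.im with hW
      have hinj : Set.InjOn Complex.im ((Zij j : Finset ℂ) : Set ℂ) := by
        intro ρ hρ ρ' hρ' heq
        by_contra hne
        have := hsep ρ (hZij_sub hρ) ρ' (hZij_sub hρ') hne
        rw [heq, sub_self, abs_zero] at this
        linarith
      have hcardW : W.card = (Zij j).card := Finset.card_image_of_injOn hinj
      -- the fixed coefficients
      set e : ℕ → ℂ := fun n ↦ if n ∈ Finset.Ioc M (2 * M) then
        c' n * (((n : ℝ) ^ (-σ) * Real.log ((n : ℝ) / M) ^ j : ℝ) : ℂ) else 0 with hedef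
      have he : ∀ n, ‖e n‖ ≤ Λ ^ 2 * (M : ℝ) ^ (-σ) := by
        intro n
        rw [hedef]; dsimp only
        split_ifs with hn
        · rw [Finset.mem_Ioc] at hn
          have hn0 : (0 : ℝ) < n := by exact_mod_cast (by omega : 0 < n)
          have hMn : (M : ℝ) ≤ n := by exact_mod_cast hn.1.le
          -- `|log(n/M)| ≤ 1`
          have hlog1 : |Real.log ((n : ℝ) / M)| ≤ 1 := by
            have h1 : (1 : ℝ) ≤ (n : ℝ) / M := by rw [le_div_iff₀ hM0, one_mul]; exact hMn
            have h2 : (n : ℝ) / M ≤ 2 := by rw [div_le_iff₀ hM0]; exact_mod_cast hn.2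
            rw [abs_of_nonneg (Real.log_nonneg h1)]
            calc Real.log ((n : ℝ) / M) ≤ Real.log 2 := Real.log_le_log (by positivity) h2
              _ ≤ 1 := by linarith [Real.log_two_lt_d9]
          have hpow1 : |Real.log ((n : ℝ) / M) ^ j| ≤ 1 := by
            rw [abs_pow]; exact pow_le_one₀ (abs_nonneg _) hlog1
          have hnσ : (n : ℝ) ^ (-σ) ≤ (M : ℝ) ^ (-σ) :=
            Real.rpow_le_rpow_of_nonpos hM0 hMn (by linarith)
          have hcn : ‖c' n‖ ≤ Λ ^ 2 := by
            calc ‖c' n‖ ≤ (n.divisors.card : ℝ) := hc' n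
              _ ≤ Λ * (n : ℝ) ^ η' := hd n
              _ ≤ Λ * (2 * (M : ℝ)) ^ η' := by gcongr; exact_mod_cast hn.2
              _ ≤ Λ * Λ := mul_le_mul_of_nonneg_left h2Mη hΛ0.le
              _ = Λ ^ 2 := by ring
          rw [norm_mul, Complex.norm_real, Real.norm_eq_abs, abs_mul,
            abs_of_nonneg (Real.rpow_nonneg hn0.le _)]
          calc ‖c' n‖ * ((n : ℝ) ^ (-σ) * |Real.log ((n : ℝ) / M) ^ j|)
              ≤ Λ ^ 2 * ((M : ℝ) ^ (-σ) * 1) := by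
                refine mul_le_mul hcn ?_ (by positivity) (by positivity)
                exact mul_le_mul hnσ hpow1 (abs_nonneg _) (Real.rpow_nonneg hM0.le _)
            _ = Λ ^ 2 * (M : ℝ) ^ (-σ) := by ring
        · rw [norm_zero]; positivity
      have hWmem : ∀ t ∈ W, 0 ≤ t ∧ t ≤ T := by
        intro t ht
        rw [hW, Finset.mem_image] at ht
        obtain ⟨ρ, hρ, rfl⟩ := ht
        obtain ⟨-, -, h0, h1⟩ := hZ ρ (hZij_sub hρ)
        exact ⟨h0, h1⟩
      have hWsep : ∀ t ∈ W, ∀ t' ∈ W, t ≠ t' → 1 ≤ |t - t'| := by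
        intro t ht t' ht' hne
        rw [hW, Finset.mem_image] at ht ht'
        obtain ⟨ρ, hρ, rfl⟩ := ht
        obtain ⟨ρ', hρ', rfl⟩ := ht'
        exact hsep ρ (hZij_sub hρ) ρ' (hZij_sub hρ') fun h ↦ hne (by rw [h])
      have hV₁Λ : 1 ≤ V₁ * Λ ^ 3 := by
        rw [hV₁, hV]
        have e : 1 / (3 * (J : ℝ)) / (2 * J₁) * Λ ^ 3 = Λ ^ 3 / (6 * (J * J₁)) := by
          field_simp; ring
        rw [e, le_div_iff₀ (by positivity), one_mul]
        have hJJ : (J : ℝ) * J₁ ≤ Λ * Λ := mul_le_mul hJ hJ₁Λ hJ₁0R.le hΛ0.le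
        calc 6 * ((J : ℝ) * J₁) ≤ 6 * (Λ * Λ) := mul_le_mul_of_nonneg_left hJJ (by norm_num)
          _ ≤ Λ * (Λ * Λ) := mul_le_mul_of_nonneg_right hΛ (by positivity)
          _ = Λ ^ 3 := by ring
      have hlargeW : ∀ t ∈ W, V₁ ≤ ‖∑ n ∈ Finset.Ioc M (2 * M), e n * (n : ℂ) ^ (-((t : ℂ) * I))‖ := by
        intro t ht
        rw [hW, Finset.mem_image] at ht
        obtain ⟨ρ, hρ, rfl⟩ := ht
        rw [hZij, Finset.mem_filter] at hρ
        have hS : ∑ n ∈ Finset.Ioc M (2 * M), e n * (n : ℂ) ^ (-((ρ.im : ℂ) * I)) = S j ρ := by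
          rw [hSdef]; dsimp only
          refine Finset.sum_congr rfl fun n hn ↦ ?_
          rw [hedef]; dsimp only; rw [if_pos hn]
        rw [hS]; exact hρ.2
      have h := block_bound hCL hL h₀ h₁ hT hT2 hΛ1 hLT hlog hdpow hMX hM2 e he W hWmem hWsep
        hV₁Λ hlargeW
      rw [hcardW] at h
      exact h
    calc ((Zi i).card : ℝ) ≤ (((Finset.range J₁).biUnion Zij).card : ℝ) := by
          exact_mod_cast Finset.card_le_card hcover'
      _ ≤ ∑ j ∈ Finset.range J₁, ((Zij j).card : ℝ) := by exact_mod_cast Finset.card_biUnion_le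
      _ ≤ ∑ j ∈ Finset.range J₁, R := Finset.sum_le_sum hclass
      _ = J₁ * R := by rw [Finset.sum_const, Finset.card_range, nsmul_eq_mul]
  -- sum over the blocks
  calc ((Z.filter (fun ρ ↦ 1 / 3 < ‖∑ n ∈ Finset.Ioc X N₀, c n * (n : ℂ) ^ (-ρ)‖)).card : ℝ)
      ≤ (((Finset.range J).biUnion Zi).card : ℝ) := by exact_mod_cast Finset.card_le_card hcover
    _ ≤ ∑ i ∈ Finset.range J, ((Zi i).card : ℝ) := by exact_mod_cast Finset.card_biUnion_le
    _ ≤ ∑ i ∈ Finset.range J, (J₁ : ℝ) * R := Finset.sum_le_sum hblock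
    _ = J * (J₁ * R) := by rw [Finset.sum_const, Finset.card_range, nsmul_eq_mul]
    _ ≤ Λ * (Λ * R) := mul_le_mul hJ (mul_le_mul_of_nonneg_right hJ₁Λ hR0) (by positivity) hΛ0.le
    _ = 16 ^ 100 * Λ ^ 1547 * T ^ κ := by rw [hR]; ring

end GuthMaynardZeroDensity

end Literature.NumberTheory.LFunctions

end
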